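import Literature.MathematicalPhysics.QuantumFieldTheory.Balaban1983to89.B14Eq364Symmetries
import Literature.MathematicalPhysics.QuantumFieldTheory.Balaban1983to89.B12Pairing543

/-!
# `Balaban1983to89.B14.Eq358ModelInstance` — T. Bałaban, *Convergent renormalization expansions for lattice gauge
# theories*, Commun. Math. Phys. **119** (1988) 243–285 [Balaban1988Convergent]: a **MODEL INSTANCE** of the hypothesis
# set of the (3.57) → (3.61) → (3.64) kernel chain — the `z`-pointed analytic localized family (2.27)(i)(ii)(iv) with the
# linearized gauge invariance (2.27)(iii) and the Euclidean covariance (3.58) for translations, axis reflections and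
# coordinate permutations IS INHABITED, by the corner-symmetrised quadratic plaquette density at scale `M = 1`; every
# hypothesis of `B14.Eq358TranslInv.translInv_kernelPt` / `kernelPt_refl` / `kernelPt_perm` / `eq361_kernelPt` and of
# `B14.Eq364Symmetries.eq364_kernelPt_of_symmetries` is DISCHARGED for it and their conclusions ((3.59), (3.61), (3.64),
# *"This function is translation invariant"*) are instantiated; the instance's kernel is NOT the zero kernel (§6)

HONEST FRAMING (cell `lit-balaban`, verbatim): statement-level skeleton of published theorems with citation tags;
proofs where landed; nothing here is a claim about the Yang–Mills mass gap.

PDF held: `paper:balaban1988-cmp119-convergent-renormalization` (journal page = PDF page + 242); pp. 259–260 [PDF 17–18]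
and pp. 281–283 [PDF 39–41] re-read for this file; [Balaban1987RG1] (4.42) p. 291 via `B12Pairing543`.

WHY THIS FILE.  The chain of record for [III] §3's second-order term — `B14.Eq358TranslInv` ((3.58) ⇒ translation
invariance, (3.59), (3.60)/(3.61)), `B14.Eq364Symmetries` ((3.64) `β′_j = β_j` with [I]'s Taylor data (I.5.16) derived) —
is a family of theorems UNIVERSALLY QUANTIFIED over a `z`-pointed analytic localized family
`g : ∀ X : Finset (Pt d), Pt d → (Fin d × ↥(sites M X) → ℂ) → ℂ` subject to ELEVEN hypotheses: `hU`/`hg`/`hRU` ((2.27)(ii):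
analytic on an open set containing the closed polydisc of radius `R`), `hA` ((2.27)(iv): `‖g X z‖ ≤ E₀e^{−κd_j(X)}` on the
polydisc), `hκ`/`hκ0` (`κ ≥ 3κ₀(4·2^d, 2d)`, `κ > 0`), `hginv` ((2.27)(iii) linearized: `g X z (B + t∂λ) = g X z B` near
`0`), and (3.58) for the translations / axis reflections / coordinate permutations (`Eq358Transl`, `Eq358Refl`,
`Eq358Perm`, stated on the whole-lattice density `density M g` = (2.27) with the unrestricted summation, p. 260).  A
universally quantified chain is only as good as its hypothesis set is consistent: THIS FILE exhibits ONE family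
satisfying all eleven at once — so none of the theorems of the chain is vacuous — and shows that its whole-lattice
kernel `Π_{μμ}(z, z, z)` is strictly positive (`d ≥ 2`), so the instance is not the zero family, for which everything
would hold trivially.  The gen-6 cell text of row B14.Eq3.62–3.64 asserted this non-vacuity in prose only (*"e.g. the
corner-symmetrised ultralocal plaquette density"*); here it is kernel-checked.

THE INSTANCE (print's objects at `j = 0`, `M = 1`, abelianised).  Scale `M = 1`: the cubes of the partition are the
sites (`coarse 1 = id`, `sites 1 X = X`).  Localization domains: `X₁(z) := □̃(z)` = `B13ScaleTransfer.block z`, the `3^d`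
sites at sup-distance `≤ 1` from `z` (a localization domain: face-connected, `d_j(□̃(z)) ≤ 3^d − 1`).  The term above
`X`: `fam X z B := [X = □̃(z)] · φ_z(B̃)`, `B̃` = `B` extended by zero (`extZero`), and
  `φ_z(C) := Σ_{μ,ν} Σ_{p = p_{μν}(x) ∋ z} ((∂C)_{μν}(x))²`   (`phi`, `quad`),
the sum over the (at most four per ordered plane) plaquettes `p_{μν}(x)`, `x ∈ {z, z − e_μ, z − e_ν, z − e_μ − e_ν}`,
having `z` as a vertex, of the squared abelian field strength `(∂C)_{μν}(x) = C_μ(x) + C_ν(x + e_μ) − C_μ(x + e_ν) −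
C_ν(x)` — [I] (4.42)'s `(∂B)_{μν}` (`B12Pairing543.curl`), i.e. the quadratic part `½Σ tr F²` of the Wilson plaquette
action ((3.66) p. 283, `B14Eq366ActionF2.plaquette366`) made ultralocal AT THE POINT `z` by keeping the plaquettes
through `z` (all four corners, so that the axis reflections — which move the initial point of a plaquette — act on the
set of plaquettes through `z`).  Its whole-lattice density (2.27) is `𝐄(U(exp iC), z) = φ_z(C)` (`density_fam`).

WHAT IS PROVED (no `sorry`; four `def`s with bodies — `extZero`, `quad`, `phi`, `fam`; nothing existing is modified):
* §1 scale `M = 1` and the domain `□̃(z)`: `coarse_one`, `mem_sites_one`, `faceConnected_block`, `treeLen_block_le`, the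
  membership of the plaquette corners in `□̃(z)`;
* §2 the instance and its algebra: linearity / homogeneity / locality of `(∂C)_{μν}(x)` and of `φ_z`
  (`curl_curry`, `quad_congr`, `phi_congr`, `phi_smul`), **`density_fam`** (the (2.27) series has the single term `X = □̃(z)`);
* §3 **(2.27)(i)(ii)(iii)(iv) DISCHARGED**: `fam_analyticOnNhd` (entire), `fam_bound` (`‖fam X z B‖ ≤ 64d²R²e^{κ(3^d−1)}·
  e^{−κd_j(X)}` on the polydisc of radius `R`, every `κ ≥ 0`), `fam_gauge`/`fam_gaugeInv` (EXACT invariance under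
  `B ↦ B + t∂λ`: the curl of a gradient vanishes on every plaquette read by `φ_z`);
* §4 **(3.58) DISCHARGED** for the three generating families of the Euclidean group of `Z^d`: `phi_shift` /
  `eq358Transl_fam` (translations), `phi_permCfg` / `eq358Perm_fam` (coordinate permutations: the plane `(μ, ν)` goes to
  `(σμ, σν)`), `phi_reflCfg` / `eq358Refl_fam` (axis reflections `r_α`, with print's `(rB)_μ(x) = −B_μ((…, −x_μ − 1, …))`
  for `μ = α`: `(∂(r_αC))_{μν}(x) = ±(∂C)_{μν}(x′)`, `x′` the initial point of the reflected plaquette, and the four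
  plaquettes through `z` in a plane are permuted — `curl_reflCfg_of_ne`, `curl_reflCfg_left`, `curl_reflCfg_right`,
  `quad_reflCfg`);
* §5 **THE CHAIN INSTANTIATED**: `translInv_fam` (*"This function is translation invariant"*), `kernelPt_fam_refl` /
  `kernelPt_fam_perm` ((3.59)), `eq361_fam` ((3.61) `Π_{μν,κτ} = δ_{μν}δ_{κτ}Π_{μ₀μ₀,κ₀κ₀}`), **`eq364_fam`** ((3.64)
  `β′_j = β_j`) — each the corresponding theorem of the chain with ALL hypotheses discharged (`R = 1`,
  `κ = 3κ₀(4·2^d, 2d) + 3`, `E₀ = 64d²e^{κ(3^d−1)}`, `U X = univ`);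
* §7 (v1.1) **THE KERNEL IN CLOSED FORM AND `β′_j = 16`**: `kernelPt_fam_eq` (`Π_{μν}(x, y, z) = Re[φ_z(δ_{(μ,x)} +
  δ_{(ν,y)}) − φ_z(δ_{(μ,x)}) − φ_z(δ_{(ν,y)})]`, polarization), `kernelPt_fam_eq_zero_left/right` (locality), `phi_polar*`
  (bilinearity of the polarized density), `curl_linearCfg`/`phi_linearCfg` (the linear configuration `W_{two}(s) = s_{one}`
  has `(∂W)_{κν} = [κ = one][ν = two] − [κ = two][ν = one]`, `φ₀(W) = 8`), **`betaPrime_fam`**: `β′_j = Σ_{x,y} Π_{22}(x, y,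
  0)x₁y₁ = 16`, and **`beta_fam`**: by `eq364_fam`, [I]'s `β` of the instance (`B12Beta.secondMoment (sumKernel …) two one`)
  is `16` — (3.64) for the instance equates two non-zero numbers;
* §6 **NON-DEGENERACY**: `kernelPt_fam_diag` (`Π_{μμ}(z, z, z) = 2·Re φ_z(δ_{(μ,z)})` by `Eq358TranslInv.kernelPt_eq_re_pderiv`
  — the kernel IS the second derivative of the density — and the homogeneity of `φ_z`), `kernelPt_fam_diag_pos`
  (`Π_{μμ}(z, z, z) > 0` as soon as a direction `ν ≠ μ` exists: the plaquette `p_{μν}(z)` contributes `1`).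
* §8 (v1.2) **THE FULL MOMENT TENSOR AND THE NECESSITY OF THE INDEX RESTRICTION OF (3.61)**: `curl_linearCfg_ite`,
  `phi_polar_linearCfg` (the polarized density of two linear configurations `W₁(s) = s_κ` in direction `μ`, `W₂(s) = s_τ`
  in direction `ν` is `16·(δ_{μν}δ_{κτ} − δ_{μτ}δ_{κν})`), **`P4_fam`**: `Π_{μν,κτ} = Σ_{x,y} Π_{μν}(x, y, 0)x_κy_τ =
  16·(δ_{μν}δ_{κτ} − δ_{μτ}δ_{κν})` for ALL indices (`B14.Eq360TensorInvariance.P4`), `P4_fam_cross` (`Π_{12,21} = −16`), and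
  **`eq361_restriction_necessary`**: the identity *"Π_{μν,κλ} = δ_{μν}δ_{κλ}Π_{μ₀μ₀,κ₀κ₀}"* of (3.61) FAILS for the instance
  when quantified over all indices (`d ≥ 2`), while it holds on print's summation range `κ < μ`, `λ < ν` of (3.57)
  (`eq361_fam`) — the index restriction typed in `Eq358TranslInv.eq361_kernelPt` / `Eq360TensorInvariance.eq361_of_covariance`
  is print's (*"Σ_{κ<μ, λ<ν}"*, p. 281) and cannot be dropped.
**Version.**  v1.2 — ADDITIVE to v1.1 (p302456) and v1 (p301649): + §8 (theorems only); every v1/v1.1 declaration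
byte-identical (v1.1 = + §7).  v1.3 — CITELOC DOCFIX ONLY (docstrings / cite tags; every declaration byte-identical to
v1.2 p306428): [I] (1.18) is p. 263 [PDF 15] (v1–v1.2 wrote «p. 261» in the references list and in `fam_bound`'s tag),
and (5.16) is p. 293 [PDF 45] — re-read on the text layer `paper:balaban1987-cmp109-rg-i-small-field` (journal page =
PDF page + 248).
Model notes.  (M10) the instance is abelian and one-scale (`j = 0`, `M = 1`, scalar bond components): it certifies the
CONSISTENCY of the hypothesis set of the chain, not any estimate of [III]; the non-abelian, multi-scale densities
`𝐄^{(j)}(X, U_j, z)` of (2.27) are print's and are not constructed here.  (M5)–(M9) as in `B14.Eq358TranslInv`.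

Mega-formalization `lit-balaban`, unit `lit-balaban-r11` gen 8 (B14 fold owner; TAKING line HOME/STATUS.md
2026-08-21T19:18:29Z; rows B14.Eq3.58–3.61 / B14.Eq3.62–3.64 / B14.Eq2.26–2.27, KIND model-instance, heads unchanged),
HOME `run/shared/lean/pub/lit-balaban/`.

## References
* [Balaban1988Convergent] T. Bałaban, Commun. Math. Phys. 119 (1988) 243–285, (2.27) p.259, (2.29) p.260, (3.50) p.280,
  p.281, (3.58)–(3.61) p.282, (3.62)–(3.66) pp.282–283.
* [Balaban1987RG1] T. Bałaban, Commun. Math. Phys. 109 (1987) 249–301 ([I]: (1.18) p.263, (4.42) p.291, (5.16) p.293).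
* [Balaban1988RG2Cluster] T. Bałaban, Commun. Math. Phys. 116 (1988) 1–22 ([II]: (1.26) p.8).
-/

namespace Literature.MathematicalPhysics.QuantumFieldTheory.Balaban1983to89.B14.Eq358ModelInstance

noncomputable section

open Literature.MathematicalPhysics.QuantumFieldTheory.GawedzkiKupiainen1985.PeriodicGleason (unitVec)
open Literature.MathematicalPhysics.QuantumFieldTheory.Balaban1983to89
open Literature.MathematicalPhysics.QuantumFieldTheory.Balaban1983to89.B13ScaleTransfer
open Literature.MathematicalPhysics.QuantumFieldTheory.Balaban1983to89.TreeLength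
open Literature.MathematicalPhysics.QuantumFieldTheory.Balaban1983to89.B12TreeDecay
open Literature.MathematicalPhysics.QuantumFieldTheory.Balaban1983to89.B14.Eq364Beta
open Literature.MathematicalPhysics.QuantumFieldTheory.Balaban1983to89.B14.Eq363SummedKernel
open Literature.MathematicalPhysics.QuantumFieldTheory.Balaban1983to89.B14.Eq357KernelDecay
open Literature.MathematicalPhysics.QuantumFieldTheory.Balaban1983to89.B14.Eq350KernelCauchy
open Literature.MathematicalPhysics.QuantumFieldTheory.Balaban1983to89.B14.Eq362Marginals (grad)
open Literature.MathematicalPhysics.QuantumFieldTheory.Balaban1983to89.B14.Eq360TensorInvariance (reflSrc permPt P4)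
open Literature.MathematicalPhysics.QuantumFieldTheory.Balaban1983to89.B14.Eq358TranslInv
open Literature.MathematicalPhysics.QuantumFieldTheory.Balaban1983to89.B14.Eq364Symmetries
open Literature.MathematicalPhysics.QuantumFieldTheory.Balaban1983to89.B12Pairing543 (curl)
open Literature.MathematicalPhysics.QuantumFieldTheory.Dimock2011to13.PolydiscCauchyBounds
open _root_.Topology Function Finset

variable {d : ℕ}

-- `B13ScaleTransfer.block z` = print's `□̃(z)` is written in full: inside this namespace the root namespace's
-- `Setup.block` takes precedence over the opened `B13ScaleTransfer.block`.

/-! ## §1. Scale `M = 1`: the cubes are the sites; the localization domain `□̃(z)` -/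

/-- At `M = 1` the cube of a site is the site: `coarse 1 x = x`. [cite: Balaban1988Convergent, (2.27)(i) p.259] -/
private theorem coarse_one (x : Pt d) : coarse 1 x = x := by
  funext i
  simp [coarse]

/-- At `M = 1` the sites of the cubes of `X` are the points of `X`. [cite: Balaban1988Convergent, (2.27)(i) p.259] -/
theorem mem_sites_one {X : Finset (Pt d)} {x : Pt d} : x ∈ sites 1 X ↔ x ∈ X := by
  rw [mem_sites one_pos, coarse_one]

/-- A single cube is a connected family of cubes. [cite: Balaban1987RG1, p.257 (localization domains)] -/
private theorem faceConnected_singleton (z : Pt d) : FaceConnected ({z} : Finset (Pt d)) := by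
  intro x hx y hy
  rw [Finset.mem_singleton] at hx hy
  subst hx
  subst hy
  exact Relation.ReflTransGen.refl

/-- `□̃(z)` is the collar of the single cube `z`. [cite: Balaban1987RG1, p.257 (definition of □̃ⁿ)] -/
theorem collar_singleton (z : Pt d) : collar ({z} : Finset (Pt d)) = B13ScaleTransfer.block z := by
  simp [collar]

/-- `□̃(z)` is a connected family of cubes. [cite: Balaban1987RG1, p.257 (definition of □̃ⁿ)] -/
theorem faceConnected_block (z : Pt d) : FaceConnected (B13ScaleTransfer.block z) := by
  rw [← collar_singleton]
  exact faceConnected_collar (faceConnected_singleton z)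

/-- `d_j(□̃(z)) ≤ 3^d − 1` (a tree through `3^d` cubes). [cite: Balaban1987RG1, p.257 (linear size d_j)] -/
theorem treeLen_block_le (z : Pt d) : treeLen (B13ScaleTransfer.block z) ≤ (3 : ℝ) ^ d - 1 := by
  have h := treeLen_le_card_sub_one ⟨z, mem_block_self z⟩ (faceConnected_block z)
  rw [card_block] at h
  push_cast at h
  exact h

/-- The coordinates of `e_μ`. [folklore] -/
private theorem unitVec_apply (μ i : Fin d) : unitVec μ i = if i = μ then 1 else 0 := rfl

/-- `z + e_μ ∈ □̃(z)`. [cite: Balaban1987RG1, p.257 (definition of □̃ⁿ)] -/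
theorem add_unitVec_mem_block (z : Pt d) (μ : Fin d) : z + unitVec μ ∈ B13ScaleTransfer.block z :=
  mem_block.2 fun i => by
    by_cases h : i = μ
    · subst h; simp [unitVec_apply]; omega
    · simp [unitVec_apply, h]

/-- `z − e_μ ∈ □̃(z)`. [cite: Balaban1987RG1, p.257 (definition of □̃ⁿ)] -/
theorem sub_unitVec_mem_block (z : Pt d) (μ : Fin d) : z - unitVec μ ∈ B13ScaleTransfer.block z :=
  mem_block.2 fun i => by
    by_cases h : i = μ
    · subst h; simp [unitVec_apply]; omega
    · simp [unitVec_apply, h]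

/-- `z − e_μ + e_ν ∈ □̃(z)`. [cite: Balaban1987RG1, p.257 (definition of □̃ⁿ)] -/
theorem sub_add_unitVec_mem_block (z : Pt d) (μ ν : Fin d) : z - unitVec μ + unitVec ν ∈ B13ScaleTransfer.block z :=
  mem_block.2 fun i => by
    by_cases h : i = μ
    · subst h
      by_cases h' : i = ν
      · subst h'; simp [unitVec_apply]
      · simp [unitVec_apply, h']; omega
    · by_cases h' : i = ν
      · subst h'; simp [unitVec_apply, h]; omega
      · simp [unitVec_apply, h, h']

/-- `z − e_μ − e_ν ∈ □̃(z)` for `μ ≠ ν`. [cite: Balaban1987RG1, p.257 (definition of □̃ⁿ)] -/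
theorem sub_sub_unitVec_mem_block (z : Pt d) {μ ν : Fin d} (hμν : μ ≠ ν) :
    z - unitVec μ - unitVec ν ∈ B13ScaleTransfer.block z :=
  mem_block.2 fun i => by
    by_cases h : i = μ
    · subst h; simp [unitVec_apply, hμν]; omega
    · by_cases h' : i = ν
      · subst h'; simp [unitVec_apply, h]; omega
      · simp [unitVec_apply, h, h']

/-- `z − e_μ − e_ν + e_μ = z − e_ν`. [folklore] -/
private theorem sub_sub_add_left (z : Pt d) (μ ν : Fin d) : z - unitVec μ - unitVec ν + unitVec μ = z - unitVec ν := by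
  abel

/-- `z − e_μ − e_ν + e_ν = z − e_μ`. [folklore] -/
private theorem sub_sub_add_right (z : Pt d) (μ ν : Fin d) : z - unitVec μ - unitVec ν + unitVec ν = z - unitVec μ :=
  sub_add_cancel _ _

/-! ## §2. The instance: the corner-symmetrised quadratic plaquette density at `z`, carried by `□̃(z)` -/

/-- Extension by zero of a configuration of bond components over the sites of `X` to the whole lattice (`M = 1`).
[cite: Balaban1988Convergent, (2.27)(i) p.259] -/
def extZero (X : Finset (Pt d)) (B : Fin d × ↥(sites 1 X) → ℂ) : Fin d × Pt d → ℂ :=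
  fun p => if h : p.2 ∈ sites 1 X then B (p.1, ⟨p.2, h⟩) else 0

/-- The squared abelian field strengths `((∂C)_{μν}(x))²` of the plaquettes `p_{μν}(x)` of the `(μ, ν)` plane having `z`
as a vertex, summed: `x ∈ {z, z − e_μ, z − e_ν, z − e_μ − e_ν}` (for `μ = ν` every term vanishes).
[cite: Balaban1987RG1, (4.42) p.291; Balaban1988Convergent, (3.66) p.283] -/
def quad (μ ν : Fin d) (z : Pt d) (C : Fin d × Pt d → ℂ) : ℂ :=
  curl (curry C) μ ν z ^ 2 + curl (curry C) μ ν (z - unitVec μ) ^ 2 + curl (curry C) μ ν (z - unitVec ν) ^ 2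
    + curl (curry C) μ ν (z - unitVec μ - unitVec ν) ^ 2

/-- **The density of the instance at the point `z`**: `φ_z(C) = Σ_{μ,ν} Σ_{p_{μν}(x) ∋ z} ((∂C)_{μν}(x))²` — the quadratic
plaquette action `½Σ tr F²` ((3.66), [I] (4.42)) made ultralocal at `z`, abelianised.
[cite: Balaban1988Convergent, (3.66) p.283; Balaban1987RG1, (4.42) p.291] -/
def phi (z : Pt d) (C : Fin d × Pt d → ℂ) : ℂ := ∑ μ, ∑ ν, quad μ ν z C

/-- **The `z`-pointed analytic localized family of the instance** ((2.27), scale `M = 1`): the term above `X` is `φ_z` of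
the zero-extended configuration if `X = □̃(z)`, and `0` otherwise. [cite: Balaban1988Convergent, (2.27) p.259] -/
def fam (X : Finset (Pt d)) (z : Pt d) (B : Fin d × ↥(sites 1 X) → ℂ) : ℂ :=
  if X = B13ScaleTransfer.block z then phi z (extZero X B) else 0

/-- `(∂C)_{μν}(x) = C_μ(x) + C_ν(x + e_μ) − C_μ(x + e_ν) − C_ν(x)`. [cite: Balaban1987RG1, (4.42) p.291] -/
theorem curl_curry (C : Fin d × Pt d → ℂ) (μ ν : Fin d) (x : Pt d) :
    curl (curry C) μ ν x = C (μ, x) + C (ν, x + unitVec μ) - C (μ, x + unitVec ν) - C (ν, x) := by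
  simp only [curl, B12Rep537.fdelta, curry]
  ring

/-- `(∂C)_{μμ} = 0`. [cite: Balaban1987RG1, (4.42) p.291] -/
theorem curl_curry_self (C : Fin d × Pt d → ℂ) (μ : Fin d) (x : Pt d) : curl (curry C) μ μ x = 0 := by
  rw [curl_curry]
  ring

/-- Additivity of `(∂C)_{μν}(x)` in `C`. [cite: Balaban1987RG1, (4.42) p.291] -/
theorem curl_curry_add (C₁ C₂ : Fin d × Pt d → ℂ) (μ ν : Fin d) (x : Pt d) :
    curl (curry (C₁ + C₂)) μ ν x = curl (curry C₁) μ ν x + curl (curry C₂) μ ν x := by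
  simp only [curl_curry, Pi.add_apply]
  ring

/-- Homogeneity of `(∂C)_{μν}(x)` in `C`. [cite: Balaban1987RG1, (4.42) p.291] -/
theorem curl_curry_smul (t : ℂ) (C : Fin d × Pt d → ℂ) (μ ν : Fin d) (x : Pt d) :
    curl (curry (t • C)) μ ν x = t * curl (curry C) μ ν x := by
  simp only [curl_curry, Pi.smul_apply, smul_eq_mul]
  ring

/-- Locality of `(∂C)_{μν}(x)`: it reads the bonds at the sites `x`, `x + e_μ`, `x + e_ν` only.
[cite: Balaban1987RG1, (4.42) p.291] -/
theorem curl_curry_congr {S : Finset (Pt d)} {C₁ C₂ : Fin d × Pt d → ℂ}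
    (h : ∀ κ, ∀ y ∈ S, C₁ (κ, y) = C₂ (κ, y)) {μ ν : Fin d} {x : Pt d} (h0 : x ∈ S) (h1 : x + unitVec μ ∈ S)
    (h2 : x + unitVec ν ∈ S) :
    curl (curry C₁) μ ν x = curl (curry C₂) μ ν x := by
  simp only [curl_curry, h _ _ h0, h _ _ h1, h _ _ h2]

/-- The degenerate plane `μ = ν` contributes nothing. [cite: Balaban1987RG1, (4.42) p.291] -/
theorem quad_self (μ : Fin d) (z : Pt d) (C : Fin d × Pt d → ℂ) : quad μ μ z C = 0 := by
  simp [quad, curl_curry_self]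

/-- **Locality of the plane sums**: `quad μ ν z` reads the bonds at the sites of `□̃(z)` only.
[cite: Balaban1988Convergent, (2.27)(i) p.259] -/
theorem quad_congr {z : Pt d} {C₁ C₂ : Fin d × Pt d → ℂ}
    (h : ∀ κ, ∀ y ∈ B13ScaleTransfer.block z, C₁ (κ, y) = C₂ (κ, y)) (μ ν : Fin d) : quad μ ν z C₁ = quad μ ν z C₂ := by
  by_cases hμν : μ = ν
  · subst hμν
    rw [quad_self, quad_self]
  simp only [quad]
  rw [curl_curry_congr h (mem_block_self z) (add_unitVec_mem_block z μ) (add_unitVec_mem_block z ν),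
    curl_curry_congr h (sub_unitVec_mem_block z μ) (by rw [sub_add_cancel]; exact mem_block_self z)
      (sub_add_unitVec_mem_block z μ ν),
    curl_curry_congr h (sub_unitVec_mem_block z ν) (sub_add_unitVec_mem_block z ν μ)
      (by rw [sub_add_cancel]; exact mem_block_self z),
    curl_curry_congr h (sub_sub_unitVec_mem_block z hμν) (by rw [sub_sub_add_left]; exact sub_unitVec_mem_block z ν)
      (by rw [sub_sub_add_right]; exact sub_unitVec_mem_block z μ)]

/-- **Locality of `φ_z`** ((2.27)(i)): it reads the bonds at the sites of `□̃(z)` only.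
[cite: Balaban1988Convergent, (2.27)(i) p.259] -/
theorem phi_congr {z : Pt d} {C₁ C₂ : Fin d × Pt d → ℂ}
    (h : ∀ κ, ∀ y ∈ B13ScaleTransfer.block z, C₁ (κ, y) = C₂ (κ, y)) : phi z C₁ = phi z C₂ := by
  simp only [phi, quad_congr h]

/-- Homogeneity of degree two of the plane sums. [cite: Balaban1987RG1, (4.42) p.291] -/
theorem quad_smul (t : ℂ) (μ ν : Fin d) (z : Pt d) (C : Fin d × Pt d → ℂ) :
    quad μ ν z (t • C) = t ^ 2 * quad μ ν z C := by
  simp only [quad, curl_curry_smul]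
  ring

/-- **Homogeneity of degree two of `φ_z`**: `φ_z(tC) = t²φ_z(C)`. [cite: Balaban1987RG1, (4.42) p.291] -/
theorem phi_smul (t : ℂ) (z : Pt d) (C : Fin d × Pt d → ℂ) : phi z (t • C) = t ^ 2 * phi z C := by
  simp only [phi, quad_smul, Finset.mul_sum]

/-- The zero extension restricted back: on the sites of `X` it is the original configuration.
[cite: Balaban1988Convergent, (2.27)(i) p.259] -/
theorem extZero_apply_of_mem {X : Finset (Pt d)} (B : Fin d × ↥(sites 1 X) → ℂ) (κ : Fin d) {y : Pt d}
    (hy : y ∈ sites 1 X) : extZero X B (κ, y) = B (κ, ⟨y, hy⟩) := by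
  simp [extZero, hy]

/-- Extending the restriction of a whole-lattice configuration gives it back on the sites of `X`.
[cite: Balaban1988Convergent, (2.27)(i) p.259] -/
theorem extZero_restr {X : Finset (Pt d)} (C : Fin d × Pt d → ℂ) (κ : Fin d) {y : Pt d} (hy : y ∈ sites 1 X) :
    extZero X (restr 1 X C) (κ, y) = C (κ, y) := by
  simp [extZero, restr, hy]

/-- The zero extension is additive. [cite: Balaban1988Convergent, (2.27)(i) p.259] -/
theorem extZero_add (X : Finset (Pt d)) (B₁ B₂ : Fin d × ↥(sites 1 X) → ℂ) :
    extZero X (B₁ + B₂) = extZero X B₁ + extZero X B₂ := by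
  funext p
  by_cases h : p.2 ∈ sites 1 X <;> simp [extZero, h]

/-- The zero extension is homogeneous. [cite: Balaban1988Convergent, (2.27)(i) p.259] -/
theorem extZero_smul (X : Finset (Pt d)) (t : ℂ) (B : Fin d × ↥(sites 1 X) → ℂ) :
    extZero X (t • B) = t • extZero X B := by
  funext p
  by_cases h : p.2 ∈ sites 1 X <;> simp [extZero, h]

/-- **The whole-lattice density (2.27) of the instance is `φ_z`**: `𝐄(U(exp iC), z) = Σ_{X ∋ z} fam X z (C↾X) = φ_z(C)` —
the series has the single non-zero term `X = □̃(z)`. [cite: Balaban1988Convergent, (2.27) p.259, (2.29) p.260] -/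
theorem density_fam (z : Pt d) (C : Fin d × Pt d → ℂ) : density 1 fam z C = phi z C := by
  unfold density
  let X₀ : LocDom d := ⟨B13ScaleTransfer.block z, ⟨z, mem_block_self z⟩, faceConnected_block z⟩
  rw [tsum_eq_single X₀]
  · have h1 : coarse 1 z ∈ X₀.1 := by
      rw [coarse_one]
      exact mem_block_self z
    rw [if_pos h1]
    show (if B13ScaleTransfer.block z = B13ScaleTransfer.block z
        then phi z (extZero (B13ScaleTransfer.block z) (restr 1 (B13ScaleTransfer.block z) C)) else 0) = phi z C
    rw [if_pos rfl]
    exact phi_congr fun κ y hy => extZero_restr C κ (mem_sites_one.2 hy)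
  · intro X hX
    have hX' : X.1 ≠ B13ScaleTransfer.block z := fun h => hX (Subtype.ext h)
    simp [fam, hX']

/-! ## §3. (2.27)(i)(ii)(iii)(iv) discharged -/

/-- Each coordinate of the zero extension is analytic (linear or zero) in the configuration.
[cite: Balaban1988Convergent, (2.27)(ii) p.259] -/
theorem analyticAt_extZero_apply (X : Finset (Pt d)) (p : Fin d × Pt d) (B₀ : Fin d × ↥(sites 1 X) → ℂ) :
    AnalyticAt ℂ (fun B => extZero X B p) B₀ := by
  unfold extZero
  split_ifs with h
  · exact (ContinuousLinearMap.proj (R := ℂ) (φ := fun _ : Fin d × ↥(sites 1 X) => ℂ)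
      (p.1, ⟨p.2, h⟩)).analyticAt B₀
  · exact analyticAt_const

/-- The field strengths of the zero extension are analytic in the configuration.
[cite: Balaban1988Convergent, (2.27)(ii) p.259] -/
theorem analyticAt_curl_extZero (X : Finset (Pt d)) (μ ν : Fin d) (x : Pt d) (B₀ : Fin d × ↥(sites 1 X) → ℂ) :
    AnalyticAt ℂ (fun B => curl (curry (extZero X B)) μ ν x) B₀ := by
  simp only [curl_curry]
  exact (((analyticAt_extZero_apply X _ B₀).add (analyticAt_extZero_apply X _ B₀)).sub
    (analyticAt_extZero_apply X _ B₀)).sub (analyticAt_extZero_apply X _ B₀)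

/-- The plane sums of the zero extension are analytic in the configuration.
[cite: Balaban1988Convergent, (2.27)(ii) p.259] -/
theorem analyticAt_quad_extZero (X : Finset (Pt d)) (μ ν : Fin d) (z : Pt d) (B₀ : Fin d × ↥(sites 1 X) → ℂ) :
    AnalyticAt ℂ (fun B => quad μ ν z (extZero X B)) B₀ := by
  unfold quad
  exact ((((analyticAt_curl_extZero X μ ν _ B₀).pow 2).add ((analyticAt_curl_extZero X μ ν _ B₀).pow 2)).add
    ((analyticAt_curl_extZero X μ ν _ B₀).pow 2)).add ((analyticAt_curl_extZero X μ ν _ B₀).pow 2)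

/-- `φ_z` of the zero extension is analytic in the configuration. [cite: Balaban1988Convergent, (2.27)(ii) p.259] -/
theorem analyticAt_phi_extZero (X : Finset (Pt d)) (z : Pt d) (B₀ : Fin d × ↥(sites 1 X) → ℂ) :
    AnalyticAt ℂ (fun B => phi z (extZero X B)) B₀ := by
  have e : (fun B => phi z (extZero X B)) = ∑ μ : Fin d, ∑ ν : Fin d, fun B => quad μ ν z (extZero X B) := by
    funext B
    simp only [phi, Finset.sum_apply]
  rw [e]
  exact Finset.analyticAt_sum _ fun μ _ => Finset.analyticAt_sum _ fun ν _ => analyticAt_quad_extZero X μ ν z B₀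

/-- **(2.27)(ii) DISCHARGED**: every term of the instance is an entire function of the bond components over the sites of
its domain. [cite: Balaban1988Convergent, (2.27)(ii) p.259] -/
theorem fam_analyticOnNhd (X : Finset (Pt d)) (z : Pt d) : AnalyticOnNhd ℂ (fam X z) Set.univ := by
  intro B _
  by_cases h : X = B13ScaleTransfer.block z
  · have e : fam X z = fun B => phi z (extZero X B) := by
      funext B
      simp [fam, h]
    rw [e]
    exact analyticAt_phi_extZero X z B
  · have e : fam X z = fun _ => 0 := by
      funext B
      simp [fam, h]
    rw [e]
    exact analyticAt_const

/-- On the polydisc of radius `R` the zero extension is bounded by `R` bondwise.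
[cite: Balaban1988Convergent, (2.27)(iv) p.259] -/
theorem norm_extZero_le {X : Finset (Pt d)} {R : ℝ} (hR : 0 ≤ R) {B : Fin d × ↥(sites 1 X) → ℂ}
    (hB : B ∈ polydisc (fun _ : Fin d × ↥(sites 1 X) => R)) (p : Fin d × Pt d) : ‖extZero X B p‖ ≤ R := by
  unfold extZero
  split_ifs with h
  · exact hB _
  · simpa using hR

/-- `|(∂C)_{μν}(x)| ≤ 4 sup|C|`. [cite: Balaban1987RG1, (4.42) p.291] -/
theorem norm_curl_curry_le {C : Fin d × Pt d → ℂ} {R : ℝ} (hC : ∀ p, ‖C p‖ ≤ R) (μ ν : Fin d) (x : Pt d) :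
    ‖curl (curry C) μ ν x‖ ≤ 4 * R := by
  rw [curl_curry]
  have h1 := norm_sub_le (C (μ, x) + C (ν, x + unitVec μ) - C (μ, x + unitVec ν)) (C (ν, x))
  have h2 := norm_sub_le (C (μ, x) + C (ν, x + unitVec μ)) (C (μ, x + unitVec ν))
  have h3 := norm_add_le (C (μ, x)) (C (ν, x + unitVec μ))
  linarith [hC (μ, x), hC (ν, x + unitVec μ), hC (μ, x + unitVec ν), hC (ν, x)]

/-- `|((∂C)_{μν}(x))²| ≤ 16 (sup|C|)²`. [cite: Balaban1987RG1, (4.42) p.291] -/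
theorem norm_curl_curry_sq_le {C : Fin d × Pt d → ℂ} {R : ℝ} (hC : ∀ p, ‖C p‖ ≤ R) (μ ν : Fin d)
    (x : Pt d) : ‖curl (curry C) μ ν x ^ 2‖ ≤ 16 * R ^ 2 := by
  rw [norm_pow]
  have h := norm_curl_curry_le hC μ ν x
  have h0 : 0 ≤ ‖curl (curry C) μ ν x‖ := norm_nonneg _
  nlinarith

/-- `|quad μ ν z C| ≤ 64 (sup|C|)²`. [cite: Balaban1987RG1, (4.42) p.291] -/
theorem norm_quad_le {C : Fin d × Pt d → ℂ} {R : ℝ} (hC : ∀ p, ‖C p‖ ≤ R) (μ ν : Fin d) (z : Pt d) :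
    ‖quad μ ν z C‖ ≤ 64 * R ^ 2 := by
  unfold quad
  have h1 := norm_curl_curry_sq_le hC μ ν z
  have h2 := norm_curl_curry_sq_le hC μ ν (z - unitVec μ)
  have h3 := norm_curl_curry_sq_le hC μ ν (z - unitVec ν)
  have h4 := norm_curl_curry_sq_le hC μ ν (z - unitVec μ - unitVec ν)
  have := norm_add_le (curl (curry C) μ ν z ^ 2 + curl (curry C) μ ν (z - unitVec μ) ^ 2
    + curl (curry C) μ ν (z - unitVec ν) ^ 2) (curl (curry C) μ ν (z - unitVec μ - unitVec ν) ^ 2)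
  have := norm_add_le (curl (curry C) μ ν z ^ 2 + curl (curry C) μ ν (z - unitVec μ) ^ 2)
    (curl (curry C) μ ν (z - unitVec ν) ^ 2)
  have := norm_add_le (curl (curry C) μ ν z ^ 2) (curl (curry C) μ ν (z - unitVec μ) ^ 2)
  linarith

/-- **`|φ_z(C)| ≤ 64d²(sup|C|)²`**. [cite: Balaban1988Convergent, (2.27)(iv) p.259] -/
theorem norm_phi_le {C : Fin d × Pt d → ℂ} {R : ℝ} (hC : ∀ p, ‖C p‖ ≤ R) (z : Pt d) :
    ‖phi z C‖ ≤ 64 * (d : ℝ) ^ 2 * R ^ 2 := by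
  unfold phi
  calc ‖∑ μ, ∑ ν, quad μ ν z C‖ ≤ ∑ μ, ‖∑ ν, quad μ ν z C‖ := norm_sum_le _ _
    _ ≤ ∑ _μ : Fin d, ∑ _ν : Fin d, 64 * R ^ 2 :=
        Finset.sum_le_sum fun μ _ => (norm_sum_le _ _).trans (Finset.sum_le_sum fun ν _ => norm_quad_le hC μ ν z)
    _ = 64 * (d : ℝ) ^ 2 * R ^ 2 := by
        simp only [Finset.sum_const, Finset.card_univ, Fintype.card_fin, nsmul_eq_mul]
        ring

/-- **(2.27)(iv) DISCHARGED** (with (2.27)(i)): on the polydisc of radius `R` every term of the instance satisfies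
`‖fam X z B‖ ≤ E₀e^{−κd_j(X)}` with `E₀ = 64d²R²e^{κ(3^d − 1)}`, for every `κ ≥ 0` — the only non-zero term sits above
`□̃(z)`, whose linear size is at most `3^d − 1`. [cite: Balaban1988Convergent, (2.27)(iv) p.259; Balaban1987RG1, (1.18) p.263] -/
theorem fam_bound {R κ : ℝ} (hR : 0 < R) (hκ : 0 ≤ κ) (X : LocDom d) (z : Pt d)
    (B : Fin d × ↥(sites 1 X.1) → ℂ) (hB : B ∈ polydisc (fun _ : Fin d × ↥(sites 1 X.1) => R)) :
    ‖fam X.1 z B‖ ≤ 64 * (d : ℝ) ^ 2 * R ^ 2 * Real.exp (κ * (3 ^ d - 1)) * Real.exp (-κ * treeLen X.1) := by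
  unfold fam
  split_ifs with h
  · have h1 : ‖phi z (extZero X.1 B)‖ ≤ 64 * (d : ℝ) ^ 2 * R ^ 2 :=
      norm_phi_le (fun p => norm_extZero_le hR.le hB p) z
    have h2 : 1 ≤ Real.exp (κ * (3 ^ d - 1)) * Real.exp (-κ * treeLen X.1) := by
      rw [← Real.exp_add]
      apply Real.one_le_exp
      have h3 : treeLen X.1 ≤ (3 : ℝ) ^ d - 1 := by
        rw [h]
        exact treeLen_block_le z
      nlinarith
    have h0 : 0 ≤ 64 * (d : ℝ) ^ 2 * R ^ 2 := by positivity
    calc ‖phi z (extZero X.1 B)‖ ≤ 64 * (d : ℝ) ^ 2 * R ^ 2 * 1 := by linarith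
      _ ≤ 64 * (d : ℝ) ^ 2 * R ^ 2 * (Real.exp (κ * (3 ^ d - 1)) * Real.exp (-κ * treeLen X.1)) :=
          mul_le_mul_of_nonneg_left h2 h0
      _ = _ := by ring
  · rw [norm_zero]
    positivity

/-- **The curl of a gradient vanishes** on every plaquette whose sites lie in `□̃(z)`: `(∂(∂λ)~)_{μν}(x) = 0` for the
zero-extended pure-gauge direction `W_λ(ν, y) = λ(y + e_ν) − λ(y)` of `B14.Eq350KernelCauchy.gaugeDir`.
[cite: Balaban1987RG1, (4.9) p.283, (4.42) p.291] -/
theorem curl_extZero_gaugeDir (z : Pt d) (lam : Pt d → ℝ) {μ ν : Fin d} {x : Pt d}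
    (h0 : x ∈ B13ScaleTransfer.block z) (h1 : x + unitVec μ ∈ B13ScaleTransfer.block z)
    (h2 : x + unitVec ν ∈ B13ScaleTransfer.block z) :
    curl (curry (extZero (B13ScaleTransfer.block z) (gaugeDir 1 (B13ScaleTransfer.block z) lam))) μ ν x = 0 := by
  rw [curl_curry, extZero_apply_of_mem _ _ (mem_sites_one.2 h0), extZero_apply_of_mem _ _ (mem_sites_one.2 h1),
    extZero_apply_of_mem _ _ (mem_sites_one.2 h2), extZero_apply_of_mem _ _ (mem_sites_one.2 h0)]
  simp only [gaugeDir, grad]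
  rw [add_right_comm x (unitVec μ) (unitVec ν)]
  push_cast
  ring

/-- The plane sums are invariant under the linearized gauge transformations `B ↦ B + t∂λ`.
[cite: Balaban1988Convergent, (2.27)(iii) p.259; Balaban1987RG1, (4.9) p.283] -/
theorem quad_gauge (μ ν : Fin d) (z : Pt d) (B : Fin d × ↥(sites 1 (B13ScaleTransfer.block z)) → ℂ) (t : ℂ)
    (lam : Pt d → ℝ) :
    quad μ ν z (extZero (B13ScaleTransfer.block z) (B + t • gaugeDir 1 (B13ScaleTransfer.block z) lam))
      = quad μ ν z (extZero (B13ScaleTransfer.block z) B) := by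
  by_cases hμν : μ = ν
  · subst hμν
    rw [quad_self, quad_self]
  rw [extZero_add, extZero_smul]
  simp only [quad, curl_curry_add, curl_curry_smul]
  rw [curl_extZero_gaugeDir z lam (mem_block_self z) (add_unitVec_mem_block z μ) (add_unitVec_mem_block z ν),
    curl_extZero_gaugeDir z lam (sub_unitVec_mem_block z μ) (by rw [sub_add_cancel]; exact mem_block_self z)
      (sub_add_unitVec_mem_block z μ ν),
    curl_extZero_gaugeDir z lam (sub_unitVec_mem_block z ν) (sub_add_unitVec_mem_block z ν μ)
      (by rw [sub_add_cancel]; exact mem_block_self z),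
    curl_extZero_gaugeDir z lam (sub_sub_unitVec_mem_block z hμν)
      (by rw [sub_sub_add_left]; exact sub_unitVec_mem_block z ν)
      (by rw [sub_sub_add_right]; exact sub_unitVec_mem_block z μ)]
  ring

/-- **(2.27)(iii), linearized, DISCHARGED — exactly, for all `B` and `t`**: `fam X z (B + t∂λ) = fam X z B`.
[cite: Balaban1988Convergent, (2.27)(iii) p.259; Balaban1987RG1, (4.9) p.283] -/
theorem fam_gauge (X : Finset (Pt d)) (z : Pt d) (lam : Pt d → ℝ) (B : Fin d × ↥(sites 1 X) → ℂ) (t : ℂ) :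
    fam X z (B + t • gaugeDir 1 X lam) = fam X z B := by
  by_cases h : X = B13ScaleTransfer.block z
  · subst h
    simp only [fam, if_true, phi, quad_gauge]
  · simp [fam, h]

/-- (2.27)(iii) in the germ form consumed by the chain (`hginv`). [cite: Balaban1988Convergent, (2.27)(iii) p.259] -/
theorem fam_gaugeInv (X : Finset (Pt d)) (z : Pt d) (lam : Pt d → ℝ) :
    ∀ᶠ B in 𝓝 (0 : Fin d × ↥(sites 1 X) → ℂ), ∀ᶠ t in 𝓝 (0 : ℂ),
      fam X z (B + t • gaugeDir 1 X lam) = fam X z B :=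
  Filter.Eventually.of_forall fun B => Filter.Eventually.of_forall fun t => fam_gauge X z lam B t

/-! ## §4. (3.58) discharged: translations, coordinate permutations, axis reflections -/

/-- Translating the configuration translates the field strength: `(∂(τ_aC))_{μν}(x) = (∂C)_{μν}(x − a)`.
[cite: Balaban1988Convergent, (3.58) p.282] -/
theorem curl_shift (a : Pt d) (C : Fin d × Pt d → ℂ) (μ ν : Fin d) (x : Pt d) :
    curl (curry (shift a C)) μ ν x = curl (curry C) μ ν (x - a) := by
  simp only [curl_curry, shift, add_sub_right_comm]

/-- The plane sums are translation covariant. [cite: Balaban1988Convergent, (3.58) p.282] -/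
theorem quad_shift (a : Pt d) (C : Fin d × Pt d → ℂ) (μ ν : Fin d) (z : Pt d) :
    quad μ ν (z + a) (shift a C) = quad μ ν z C := by
  have e1 : z + a - a = z := add_sub_cancel_right z a
  have e2 : z + a - unitVec μ - a = z - unitVec μ := by abel
  have e3 : z + a - unitVec ν - a = z - unitVec ν := by abel
  have e4 : z + a - unitVec μ - unitVec ν - a = z - unitVec μ - unitVec ν := by abel
  simp only [quad, curl_shift, e1, e2, e3, e4]

/-- **(3.58) for translations**: `φ_{z+a}(τ_aC) = φ_z(C)`. [cite: Balaban1988Convergent, (3.58) p.282, (2.29) p.260] -/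
theorem phi_shift (a : Pt d) (C : Fin d × Pt d → ℂ) (z : Pt d) : phi (z + a) (shift a C) = phi z C := by
  simp only [phi, quad_shift]

/-- **`Eq358Transl` DISCHARGED** for the instance (any radius). [cite: Balaban1988Convergent, (3.58) p.282] -/
theorem eq358Transl_fam (R : ℝ) : Eq358Transl 1 (fam (d := d)) R := fun a z C _ => by
  rw [density_fam, density_fam, phi_shift]

/-- `σ⁻¹(x + y) = σ⁻¹x + σ⁻¹y`. [cite: Balaban1988Convergent, (3.59) p.282] -/
private theorem permPt_add (σ : Equiv.Perm (Fin d)) (x y : Pt d) : permPt σ (x + y) = permPt σ x + permPt σ y := rfl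

/-- `σ⁻¹(x − y) = σ⁻¹x − σ⁻¹y`. [cite: Balaban1988Convergent, (3.59) p.282] -/
private theorem permPt_sub (σ : Equiv.Perm (Fin d)) (x y : Pt d) : permPt σ (x - y) = permPt σ x - permPt σ y := rfl

/-- `σe_μ = e_{σμ}`. [cite: Balaban1988Convergent, (3.59) p.282] -/
private theorem permPt_unitVec (σ : Equiv.Perm (Fin d)) (μ : Fin d) : permPt σ (unitVec μ) = unitVec (σ μ) := by
  funext i
  simp only [permPt, unitVec_apply, Equiv.symm_apply_eq]

/-- `σ⁻¹(σz) = z`. [cite: Balaban1988Convergent, (3.59) p.282] -/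
private theorem permPt_symm_permPt (σ : Equiv.Perm (Fin d)) (z : Pt d) : permPt σ.symm (permPt σ z) = z := by
  funext i
  simp [permPt]

/-- Permuting the coordinates permutes the planes of the field strength:
`(∂(σC))_{μ'ν'}(x) = (∂C)_{σ⁻¹μ',σ⁻¹ν'}(σ⁻¹x)`. [cite: Balaban1988Convergent, (3.58)–(3.59) p.282] -/
theorem curl_permCfg (σ : Equiv.Perm (Fin d)) (C : Fin d × Pt d → ℂ) (μ' ν' : Fin d) (x : Pt d) :
    curl (curry (permCfg σ C)) μ' ν' x = curl (curry C) (σ.symm μ') (σ.symm ν') (permPt σ.symm x) := by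
  simp only [curl_curry, permCfg, permPt_add, permPt_unitVec]

/-- The plane sums are permutation covariant. [cite: Balaban1988Convergent, (3.58)–(3.59) p.282] -/
theorem quad_permCfg (σ : Equiv.Perm (Fin d)) (C : Fin d × Pt d → ℂ) (μ' ν' : Fin d) (z : Pt d) :
    quad μ' ν' (permPt σ z) (permCfg σ C) = quad (σ.symm μ') (σ.symm ν') z C := by
  simp only [quad, curl_permCfg, permPt_sub, permPt_unitVec, permPt_symm_permPt]

/-- **(3.58) for coordinate permutations**: `φ_{σz}(σC) = φ_z(C)`. [cite: Balaban1988Convergent, (3.58) p.282, (2.29) p.260] -/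
theorem phi_permCfg (σ : Equiv.Perm (Fin d)) (C : Fin d × Pt d → ℂ) (z : Pt d) :
    phi (permPt σ z) (permCfg σ C) = phi z C := by
  simp only [phi, quad_permCfg]
  exact Fintype.sum_equiv σ.symm _ _ fun μ' => Fintype.sum_equiv σ.symm _ _ fun ν' => rfl

/-- **`Eq358Perm` DISCHARGED** for the instance (any radius). [cite: Balaban1988Convergent, (3.58) p.282] -/
theorem eq358Perm_fam (R : ℝ) : Eq358Perm 1 (fam (d := d)) R := fun σ z C _ => by
  rw [density_fam, density_fam, phi_permCfg]

/-- For `μ ≠ α` the source point of `(r_αB)_μ(x)` is `r_αx`. [cite: Balaban1988Convergent, (3.58) p.282] -/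
theorem reflSrc_of_ne {α μ : Fin d} (h : μ ≠ α) (x : Pt d) : reflSrc α μ x = reflPt α x := by
  funext i
  simp [reflSrc, reflPt, h]

/-- For `μ = α` the source point of `(r_αB)_α(x)` is `r_αx − e_α` (print: *"(…, −x_μ − 1, …)"*).
[cite: Balaban1988Convergent, (3.58) p.282] -/
theorem reflSrc_self (α : Fin d) (x : Pt d) : reflSrc α α x = reflPt α x - unitVec α := by
  funext i
  by_cases hi : i = α
  · subst hi; simp [reflSrc, reflPt, unitVec_apply]
  · simp [reflSrc, reflPt, unitVec_apply, hi]

/-- `s_α(μ) = 1` for `μ ≠ α`. [cite: Balaban1988Convergent, (3.58) p.282] -/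
theorem axisSign_of_ne {α μ : Fin d} (h : μ ≠ α) : (B14Sect3.axisSign α μ : ℂ) = 1 := by
  simp [B14Sect3.axisSign, h]

/-- `s_α(α) = −1`. [cite: Balaban1988Convergent, (3.58) p.282] -/
theorem axisSign_self (α : Fin d) : (B14Sect3.axisSign α α : ℂ) = -1 := by
  simp [B14Sect3.axisSign]

/-- `r_α` is additive. [cite: Balaban1988Convergent, (3.58) p.282] -/
theorem reflPt_add (α : Fin d) (x y : Pt d) : reflPt α (x + y) = reflPt α x + reflPt α y := by
  funext i
  simp only [reflPt, Pi.add_apply]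
  split_ifs <;> ring

/-- `r_α` respects differences. [cite: Balaban1988Convergent, (3.58) p.282] -/
theorem reflPt_sub (α : Fin d) (x y : Pt d) : reflPt α (x - y) = reflPt α x - reflPt α y := by
  funext i
  simp only [reflPt, Pi.sub_apply]
  split_ifs <;> ring

/-- `r_αe_μ = e_μ` for `μ ≠ α`. [cite: Balaban1988Convergent, (3.58) p.282] -/
theorem reflPt_unitVec_of_ne {α μ : Fin d} (h : μ ≠ α) : reflPt α (unitVec μ) = unitVec μ := by
  funext i
  by_cases hi : i = α
  · subst hi; simp [reflPt, unitVec_apply, h.symm]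
  · simp [reflPt, unitVec_apply, hi]

/-- `r_αe_α = −e_α`. [cite: Balaban1988Convergent, (3.58) p.282] -/
theorem reflPt_unitVec_self (α : Fin d) : reflPt α (unitVec α) = -unitVec α := by
  funext i
  by_cases hi : i = α
  · subst hi; simp [reflPt, unitVec_apply]
  · simp [reflPt, unitVec_apply, hi]

/-- Reflection in a hyperplane `x_α = 0` transverse to the plane: `(∂(r_αC))_{μν}(x) = (∂C)_{μν}(r_αx)` (`α ∉ {μ, ν}`).
[cite: Balaban1988Convergent, (3.58) p.282] -/
theorem curl_reflCfg_of_ne {α μ ν : Fin d} (hμ : μ ≠ α) (hν : ν ≠ α) (C : Fin d × Pt d → ℂ) (x : Pt d) :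
    curl (curry (reflCfg α C)) μ ν x = curl (curry C) μ ν (reflPt α x) := by
  simp only [curl_curry, reflCfg, axisSign_of_ne hμ, axisSign_of_ne hν, reflSrc_of_ne hμ, reflSrc_of_ne hν,
    reflPt_add, reflPt_unitVec_of_ne hμ, reflPt_unitVec_of_ne hν, one_mul]

/-- Reflection in the hyperplane `x_μ = 0`: `(∂(r_μC))_{μν}(x) = −(∂C)_{μν}(r_μx − e_μ)` — the reflected plaquette has
initial point `r_μx − e_μ` and reversed `μ`-orientation (`ν ≠ μ`). [cite: Balaban1988Convergent, (3.58) p.282] -/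
theorem curl_reflCfg_left {μ ν : Fin d} (hν : ν ≠ μ) (C : Fin d × Pt d → ℂ) (x : Pt d) :
    curl (curry (reflCfg μ C)) μ ν x = -curl (curry C) μ ν (reflPt μ x - unitVec μ) := by
  have p2 : reflSrc μ ν (x + unitVec μ) = reflPt μ x - unitVec μ := by
    rw [reflSrc_of_ne hν, reflPt_add, reflPt_unitVec_self, ← sub_eq_add_neg]
  have p3 : reflSrc μ μ (x + unitVec ν) = reflPt μ x - unitVec μ + unitVec ν := by
    rw [reflSrc_self, reflPt_add, reflPt_unitVec_of_ne hν, add_sub_right_comm]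
  simp only [curl_curry, reflCfg, reflSrc_self μ x, p2, p3, reflSrc_of_ne hν x, axisSign_self, axisSign_of_ne hν,
    sub_add_cancel]
  ring

/-- Reflection in the hyperplane `x_ν = 0`: `(∂(r_νC))_{μν}(x) = −(∂C)_{μν}(r_νx − e_ν)` (`μ ≠ ν`).
[cite: Balaban1988Convergent, (3.58) p.282] -/
theorem curl_reflCfg_right {μ ν : Fin d} (hμ : μ ≠ ν) (C : Fin d × Pt d → ℂ) (x : Pt d) :
    curl (curry (reflCfg ν C)) μ ν x = -curl (curry C) μ ν (reflPt ν x - unitVec ν) := by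
  have p2 : reflSrc ν ν (x + unitVec μ) = reflPt ν x - unitVec ν + unitVec μ := by
    rw [reflSrc_self, reflPt_add, reflPt_unitVec_of_ne hμ, add_sub_right_comm]
  have p3 : reflSrc ν μ (x + unitVec ν) = reflPt ν x - unitVec ν := by
    rw [reflSrc_of_ne hμ, reflPt_add, reflPt_unitVec_self, ← sub_eq_add_neg]
  simp only [curl_curry, reflCfg, reflSrc_of_ne hμ x, p2, p3, reflSrc_self ν x, axisSign_self, axisSign_of_ne hμ,
    sub_add_cancel]
  ring

/-- **The four plaquettes through `z` in a plane are permuted by an axis reflection**, up to orientation: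
`quad μ ν (r_αz) (r_αC) = quad μ ν z C`. [cite: Balaban1988Convergent, (3.58) p.282, (2.29) p.260] -/
theorem quad_reflCfg (α μ ν : Fin d) (z : Pt d) (C : Fin d × Pt d → ℂ) :
    quad μ ν (reflPt α z) (reflCfg α C) = quad μ ν z C := by
  by_cases hμν : μ = ν
  · subst hμν
    rw [quad_self, quad_self]
  by_cases hμ : μ = α
  · subst hμ
    have hν : ν ≠ μ := fun h => hμν h.symm
    have e1 : reflPt μ (reflPt μ z) - unitVec μ = z - unitVec μ := by rw [reflPt_reflPt]
    have e2 : reflPt μ (reflPt μ z - unitVec μ) - unitVec μ = z := by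
      rw [reflPt_sub, reflPt_reflPt, reflPt_unitVec_self]; abel
    have e3 : reflPt μ (reflPt μ z - unitVec ν) - unitVec μ = z - unitVec μ - unitVec ν := by
      rw [reflPt_sub, reflPt_reflPt, reflPt_unitVec_of_ne hν]; abel
    have e4 : reflPt μ (reflPt μ z - unitVec μ - unitVec ν) - unitVec μ = z - unitVec ν := by
      rw [reflPt_sub, reflPt_sub, reflPt_reflPt, reflPt_unitVec_self, reflPt_unitVec_of_ne hν]; abel
    simp only [quad, curl_reflCfg_left hν, e1, e2, e3, e4]
    ring
  by_cases hν : ν = α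
  · subst hν
    have e1 : reflPt ν (reflPt ν z) - unitVec ν = z - unitVec ν := by rw [reflPt_reflPt]
    have e2 : reflPt ν (reflPt ν z - unitVec μ) - unitVec ν = z - unitVec μ - unitVec ν := by
      rw [reflPt_sub, reflPt_reflPt, reflPt_unitVec_of_ne hμν]
    have e3 : reflPt ν (reflPt ν z - unitVec ν) - unitVec ν = z := by
      rw [reflPt_sub, reflPt_reflPt, reflPt_unitVec_self]; abel
    have e4 : reflPt ν (reflPt ν z - unitVec μ - unitVec ν) - unitVec ν = z - unitVec μ := by
      rw [reflPt_sub, reflPt_sub, reflPt_reflPt, reflPt_unitVec_self, reflPt_unitVec_of_ne hμν]; abel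
    simp only [quad, curl_reflCfg_right hμν, e1, e2, e3, e4]
    ring
  simp only [quad, curl_reflCfg_of_ne hμ hν, reflPt_sub, reflPt_reflPt, reflPt_unitVec_of_ne hμ,
    reflPt_unitVec_of_ne hν]

/-- **(3.58) for axis reflections**: `φ_{r_αz}(r_αC) = φ_z(C)`. [cite: Balaban1988Convergent, (3.58) p.282, (2.29) p.260] -/
theorem phi_reflCfg (α : Fin d) (C : Fin d × Pt d → ℂ) (z : Pt d) : phi (reflPt α z) (reflCfg α C) = phi z C := by
  simp only [phi, quad_reflCfg]

/-- **`Eq358Refl` DISCHARGED** for the instance (any radius). [cite: Balaban1988Convergent, (3.58) p.282] -/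
theorem eq358Refl_fam (R : ℝ) : Eq358Refl 1 (fam (d := d)) R := fun α z C _ => by
  rw [density_fam, density_fam, phi_reflCfg]

/-! ## §5. The chain instantiated: every hypothesis discharged -/

/-- The constants of the instance: `κ = 3κ₀(4·2^d, 2d) + 3 > 0`. [cite: Balaban1988RG2Cluster, (1.26) p.8] -/
theorem kap_pos : 0 < 3 * kappa₀ (4 * 2 ^ d) (2 * d) + 3 := by
  have := kappa₀_nonneg (c₀ := 4 * 2 ^ d) (by positivity) (2 * d)
  linarith

/-- `κ₀(4·2^d, 2d) ≤ κ/3`. [cite: Balaban1988RG2Cluster, (1.26) p.8] -/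
theorem kappa₀_le_kap_div : kappa₀ (4 * 2 ^ d) (2 * d) ≤ (3 * kappa₀ (4 * 2 ^ d) (2 * d) + 3) / 3 := by
  linarith

/-- `κ₀(4·2^d, 2d) ≤ κ`. [cite: Balaban1988RG2Cluster, (1.26) p.8] -/
theorem kappa₀_le_kap : kappa₀ (4 * 2 ^ d) (2 * d) ≤ 3 * kappa₀ (4 * 2 ^ d) (2 * d) + 3 :=
  kappa₀_le_kap_div.trans (by linarith [kap_pos (d := d)])

/-- (2.27)(iv) of the instance at radius `1` with the rate `κ = 3κ₀ + 3`. [cite: Balaban1988Convergent, (2.27)(iv) p.259] -/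
theorem fam_bound_one (X : LocDom d) (z : Pt d) :
    ∀ s ∈ polydisc (fun _ : Fin d × ↥(sites 1 X.1) => (1 : ℝ)),
      ‖fam X.1 z s‖ ≤ 64 * (d : ℝ) ^ 2 * 1 ^ 2 * Real.exp ((3 * kappa₀ (4 * 2 ^ d) (2 * d) + 3) * (3 ^ d - 1))
        * Real.exp (-(3 * kappa₀ (4 * 2 ^ d) (2 * d) + 3) * treeLen X.1) :=
  fun s hs => fam_bound one_pos kap_pos.le X z s hs

/-- **p. 281 *"This function is translation invariant"* FOR THE INSTANCE**: `Eq358TranslInv.translInv_kernelPt` with every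
hypothesis discharged. [cite: Balaban1988Convergent, p.281 (This function is translation invariant)] -/
theorem translInv_fam : TranslInv (kernelPt 1 (fam (d := d))) :=
  translInv_kernelPt (U := fun _ => Set.univ) (fun X z => fam_analyticOnNhd X z) one_pos
    (fun _ => Set.subset_univ _) fam_bound_one kappa₀_le_kap (eq358Transl_fam 1)

/-- **(3.59) for the axis reflections FOR THE INSTANCE**: `Eq358TranslInv.kernelPt_refl` with every hypothesis
discharged. [cite: Balaban1988Convergent, (3.59) p.282] -/
theorem kernelPt_fam_refl (α μ ν : Fin d) (x y z : Pt d) :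
    kernelPt 1 (fam (d := d)) μ ν x y z = B14Sect3.axisSign α μ * B14Sect3.axisSign α ν
      * kernelPt 1 (fam (d := d)) μ ν (reflSrc α μ x) (reflSrc α ν y) (reflPt α z) :=
  kernelPt_refl (U := fun _ => Set.univ) (fun X z => fam_analyticOnNhd X z) one_pos
    (fun _ => Set.subset_univ _) fam_bound_one kappa₀_le_kap (eq358Refl_fam 1) α μ ν x y z

/-- **(3.59) for the coordinate permutations FOR THE INSTANCE**: `Eq358TranslInv.kernelPt_perm` with every hypothesis
discharged. [cite: Balaban1988Convergent, (3.59) p.282] -/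
theorem kernelPt_fam_perm (σ : Equiv.Perm (Fin d)) (μ ν : Fin d) (x y z : Pt d) :
    kernelPt 1 (fam (d := d)) μ ν x y z
      = kernelPt 1 (fam (d := d)) (σ μ) (σ ν) (permPt σ x) (permPt σ y) (permPt σ z) :=
  kernelPt_perm (U := fun _ => Set.univ) (fun X z => fam_analyticOnNhd X z) one_pos
    (fun _ => Set.subset_univ _) fam_bound_one kappa₀_le_kap (eq358Perm_fam 1) σ μ ν x y z

/-- **(3.64) `β′_j = β_j` FOR THE INSTANCE**: `Eq364Symmetries.eq364_kernelPt_of_symmetries` with ALL ELEVEN hypotheses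
discharged — the hypothesis set of the (3.57) → (3.61) → (3.64) chain is consistent.
[cite: Balaban1988Convergent, (3.64) p.283 ("This is the required equality"), (2.27) p.259, (3.58) p.282] -/
theorem eq364_fam {one two : Fin d} (h12 : two ≠ one) :
    betaPrime (kernelPt 1 (fam (d := d))) one two
      = B12Beta.secondMoment (sumKernel (kernelPt 1 (fam (d := d)))) two one :=
  eq364_kernelPt_of_symmetries one_pos (U := fun _ => Set.univ) (fun _ => isOpen_univ)
    (fun X z => fam_analyticOnNhd X z) one_pos (by positivity) (fun _ => Set.subset_univ _) fam_bound_one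
    kappa₀_le_kap_div kap_pos fam_gaugeInv (eq358Transl_fam 1) (eq358Refl_fam 1) (eq358Perm_fam 1) h12

/-- **(3.61) FOR THE INSTANCE**: `Eq358TranslInv.eq361_kernelPt` with all hypotheses discharged — on `κ < μ`, `τ < ν`,
`Π_{μν,κτ} = δ_{μν}δ_{κτ}Π_{μ₀μ₀,κ₀κ₀}`. [cite: Balaban1988Convergent, (3.59)–(3.61) p.282] -/
theorem eq361_fam {μ₀ κ₀ : Fin d} (h₀ : κ₀ ≠ μ₀) :
    ∀ μ ν κ' τ, κ' < μ → τ < ν →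
      P4 (kernelPt 1 (fam (d := d))) μ ν κ' τ
        = if (μ = ν ∧ κ' = τ) then P4 (kernelPt 1 (fam (d := d))) μ₀ μ₀ κ₀ κ₀ else 0 :=
  eq361_kernelPt one_pos (Fin.pos μ₀) (U := fun _ => Set.univ) (fun _ => isOpen_univ)
    (fun X z => fam_analyticOnNhd X z) one_pos (by positivity) (fun _ => Set.subset_univ _) fam_bound_one
    kappa₀_le_kap_div kap_pos fam_gaugeInv (eq358Refl_fam 1) (eq358Perm_fam 1) h₀

/-! ## §6. Non-degeneracy: the kernel of the instance is not the zero kernel -/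

/-- Probing one bond twice: `probe_{b,b}(w) = (w₀ + w₁)δ_b`. [cite: Balaban1988Convergent, (3.50) p.280] -/
theorem probe_same (b : Fin d × Pt d) (w : Fin 2 → ℂ) :
    probe b b w = (w 0 + w 1) • (Pi.single b (1 : ℂ) : Fin d × Pt d → ℂ) := by
  funext p
  by_cases h : p = b
  · subst h; simp [probe]
  · simp [probe, h]

/-- The density of the instance probed twice along the bond `b`: `w ↦ (w₀ + w₁)²φ_z(δ_b)`.
[cite: Balaban1988Convergent, (3.50) p.280, (2.27) p.259] -/
theorem probeFn_fam_same (z : Pt d) (b : Fin d × Pt d) :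
    probeFn 1 fam z b b = fun w => (w 0 + w 1) ^ 2 * phi z (Pi.single b 1) := by
  funext w
  simp only [probeFn, density_fam, probe_same, phi_smul]

/-- `∂₁[(w₀ + w₁)²N] = 2(w₀ + w₁)N`. [cite: Balaban1988Convergent, (3.50) p.280] -/
theorem pderiv_one_sq_mul (N : ℂ) (w : Fin 2 → ℂ) :
    pderiv 1 (fun v : Fin 2 → ℂ => (v 0 + v 1) ^ 2 * N) w = 2 * (w 0 + w 1) * N := by
  unfold pderiv
  have e : (fun t : ℂ => (update w 1 t 0 + update w 1 t 1) ^ 2 * N) = fun t => (w 0 + t) ^ 2 * N := by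
    funext t
    rw [update_of_ne (by decide : (0 : Fin 2) ≠ 1), update_self]
  rw [e]
  have h1 : HasDerivAt (fun t : ℂ => (w 0 + t) ^ 2) (2 * (w 0 + w 1)) (w 1) := by
    simpa [Pi.pow_def] using ((hasDerivAt_id' (w 1)).const_add (w 0)).pow 2
  exact (h1.mul_const N).deriv

/-- `∂₀∂₁[(w₀ + w₁)²N](0) = 2N`. [cite: Balaban1988Convergent, (3.50) p.280] -/
theorem pderiv_pderiv_sq_mul (N : ℂ) :
    pderiv 0 (pderiv 1 (fun v : Fin 2 → ℂ => (v 0 + v 1) ^ 2 * N)) 0 = 2 * N := by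
  have e1 : pderiv 1 (fun v : Fin 2 → ℂ => (v 0 + v 1) ^ 2 * N) = fun w => 2 * (w 0 + w 1) * N :=
    funext (pderiv_one_sq_mul N)
  rw [e1]
  unfold pderiv
  have e : (fun t : ℂ => 2 * (update (0 : Fin 2 → ℂ) 0 t 0 + update (0 : Fin 2 → ℂ) 0 t 1) * N)
      = fun t => 2 * N * t := by
    funext t
    rw [update_self, update_of_ne (by decide : (1 : Fin 2) ≠ 0), Pi.zero_apply, add_zero]
    ring
  rw [e]
  have h : HasDerivAt (fun t : ℂ => 2 * N * t) (2 * N * 1) ((0 : Fin 2 → ℂ) 0) := (hasDerivAt_id' _).const_mul _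
  rw [h.deriv, mul_one]

/-- **The diagonal of the whole-lattice kernel of the instance**: `Π_{μμ}(z, z, z) = 2 Re φ_z(δ_{(μ,z)})` — by
`Eq358TranslInv.kernelPt_eq_re_pderiv` (the kernel IS the second derivative of the whole-lattice density, all its
hypotheses discharged) and the homogeneity of `φ_z`. [cite: Balaban1988Convergent, (3.50) p.280, p.281] -/
theorem kernelPt_fam_diag (μ : Fin d) (z : Pt d) :
    kernelPt 1 (fam (d := d)) μ μ z z z = 2 * (phi z (Pi.single (μ, z) 1)).re := by
  rw [kernelPt_eq_re_pderiv (U := fun _ => Set.univ) (fun X z => fam_analyticOnNhd X z) one_pos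
    (fun _ => Set.subset_univ _) fam_bound_one kappa₀_le_kap μ μ z z z, probeFn_fam_same, pderiv_pderiv_sq_mul,
    show (2 : ℂ) = ((2 : ℝ) : ℂ) by norm_num, Complex.re_ofReal_mul]

/-- `δ_b` is a real configuration. [folklore] -/
private theorem single_im (b p : Fin d × Pt d) : ((Pi.single b (1 : ℂ) : Fin d × Pt d → ℂ) p).im = 0 := by
  by_cases h : p = b
  · subst h; simp
  · simp [Pi.single_eq_of_ne h]

/-- The field strengths of `δ_b` are real. [cite: Balaban1987RG1, (4.42) p.291] -/
theorem curl_single_im (b : Fin d × Pt d) (κ ν : Fin d) (y : Pt d) :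
    (curl (curry (Pi.single b (1 : ℂ) : Fin d × Pt d → ℂ)) κ ν y).im = 0 := by
  simp only [curl_curry, Complex.sub_im, Complex.add_im, single_im, add_zero, sub_zero]

/-- The squared field strengths of `δ_b` have real part a square. [cite: Balaban1987RG1, (4.42) p.291] -/
theorem curl_single_sq_re (b : Fin d × Pt d) (κ ν : Fin d) (y : Pt d) :
    (curl (curry (Pi.single b (1 : ℂ) : Fin d × Pt d → ℂ)) κ ν y ^ 2).re
      = (curl (curry (Pi.single b (1 : ℂ) : Fin d × Pt d → ℂ)) κ ν y).re ^ 2 := by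
  rw [pow_two, Complex.mul_re, curl_single_im]
  ring

/-- The plane sums of `δ_b` have non-negative real part. [cite: Balaban1987RG1, (4.42) p.291] -/
theorem quad_single_re_nonneg (b : Fin d × Pt d) (κ ν : Fin d) (z : Pt d) :
    0 ≤ (quad κ ν z (Pi.single b (1 : ℂ))).re := by
  simp only [quad, Complex.add_re, curl_single_sq_re]
  positivity

/-- `z + e_ν ≠ z`. [folklore] -/
private theorem add_unitVec_ne (z : Pt d) (ν : Fin d) : z + unitVec ν ≠ z := by
  intro h
  have := congr_fun h ν
  simp [unitVec_apply] at this

/-- **The plaquette `p_{μν}(z)` sees the bond `(μ, z)` once**: `(∂δ_{(μ,z)})_{μν}(z) = 1` (`ν ≠ μ`).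
[cite: Balaban1987RG1, (4.42) p.291] -/
theorem curl_single_self {μ ν : Fin d} (hμν : ν ≠ μ) (z : Pt d) :
    curl (curry (Pi.single (μ, z) (1 : ℂ) : Fin d × Pt d → ℂ)) μ ν z = 1 := by
  have h1 : ((ν, z + unitVec μ) : Fin d × Pt d) ≠ (μ, z) := fun h => hμν (Prod.ext_iff.1 h).1
  have h2 : ((μ, z + unitVec ν) : Fin d × Pt d) ≠ (μ, z) := fun h => add_unitVec_ne z ν (Prod.ext_iff.1 h).2
  have h3 : ((ν, z) : Fin d × Pt d) ≠ (μ, z) := fun h => hμν (Prod.ext_iff.1 h).1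
  rw [curl_curry, Pi.single_eq_same, Pi.single_eq_of_ne h1, Pi.single_eq_of_ne h2, Pi.single_eq_of_ne h3]
  ring

/-- `Re φ_z(δ_{(μ,z)}) ≥ 1` as soon as a direction `ν ≠ μ` exists. [cite: Balaban1987RG1, (4.42) p.291] -/
theorem one_le_re_phi_single {μ ν : Fin d} (hμν : ν ≠ μ) (z : Pt d) :
    1 ≤ (phi z (Pi.single (μ, z) (1 : ℂ))).re := by
  set δ : Fin d × Pt d → ℂ := Pi.single (μ, z) (1 : ℂ) with hδ
  have hq : 1 ≤ (quad μ ν z δ).re := by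
    simp only [quad, Complex.add_re, hδ, curl_single_sq_re, curl_single_self hμν z, one_pow, Complex.one_re]
    nlinarith [sq_nonneg (curl (curry (Pi.single (μ, z) (1 : ℂ) : Fin d × Pt d → ℂ)) μ ν (z - unitVec μ)).re,
      sq_nonneg (curl (curry (Pi.single (μ, z) (1 : ℂ) : Fin d × Pt d → ℂ)) μ ν (z - unitVec ν)).re,
      sq_nonneg (curl (curry (Pi.single (μ, z) (1 : ℂ) : Fin d × Pt d → ℂ)) μ ν (z - unitVec μ - unitVec ν)).re]
  have h1 : (quad μ ν z δ).re ≤ (∑ ν', quad μ ν' z δ).re := by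
    rw [Complex.re_sum]
    exact Finset.single_le_sum (f := fun ν' => (quad μ ν' z δ).re)
      (fun ν' _ => quad_single_re_nonneg (μ, z) μ ν' z) (Finset.mem_univ ν)
  have h2 : (∑ ν', quad μ ν' z δ).re ≤ ∑ κ, (∑ ν', quad κ ν' z δ).re :=
    Finset.single_le_sum (f := fun κ => (∑ ν', quad κ ν' z δ).re)
      (fun κ _ => by
        rw [Complex.re_sum]
        exact Finset.sum_nonneg fun ν' _ => quad_single_re_nonneg (μ, z) κ ν' z) (Finset.mem_univ μ)
  have h3 : (phi z δ).re = ∑ κ, (∑ ν', quad κ ν' z δ).re := by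
    unfold phi
    rw [Complex.re_sum]
  linarith

/-- **NON-DEGENERACY OF THE INSTANCE**: its whole-lattice kernel has `Π_{μμ}(z, z, z) ≥ 2 > 0` whenever a direction
`ν ≠ μ` exists (`d ≥ 2`) — the instance for which (3.59), (3.61), (3.64) were just instantiated is not the zero family.
[cite: Balaban1988Convergent, (3.50) p.280, (3.61) p.282, (3.64) p.283] -/
theorem kernelPt_fam_diag_pos {μ ν : Fin d} (hμν : ν ≠ μ) (z : Pt d) :
    0 < kernelPt 1 (fam (d := d)) μ μ z z z := by
  rw [kernelPt_fam_diag]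
  have := one_le_re_phi_single hμν z
  linarith

/-! ## §7 (v1.1). The kernel of the instance in closed form; `β′_j = 16` -/

/-- `φ_z(0) = 0`. [cite: Balaban1988Convergent, (2.27) p.259] -/
theorem phi_zero (z : Pt d) : phi z (0 : Fin d × Pt d → ℂ) = 0 := by
  simp [phi, quad, curl_curry]

/-- Two-term linearity of the field strength in the configuration. [cite: Balaban1987RG1, (4.42) p.291] -/
theorem curl_curry_lin2 (a b : ℂ) (C D : Fin d × Pt d → ℂ) (κ ν : Fin d) (w : Pt d) :
    curl (curry (a • C + b • D)) κ ν w = a * curl (curry C) κ ν w + b * curl (curry D) κ ν w := by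
  rw [curl_curry_add, curl_curry_smul, curl_curry_smul]

/-- The plane sums along a two-parameter family: `quad(aC + bD) = a²quad(C) + ab[quad(C + D) − quad(C) − quad(D)] +
b²quad(D)` (polarization of a quadratic form). [cite: Balaban1987RG1, (4.42) p.291] -/
theorem quad_lin2 (a b : ℂ) (C D : Fin d × Pt d → ℂ) (κ ν : Fin d) (z : Pt d) :
    quad κ ν z (a • C + b • D) = a ^ 2 * quad κ ν z C
      + a * b * (quad κ ν z (C + D) - quad κ ν z C - quad κ ν z D) + b ^ 2 * quad κ ν z D := by
  simp only [quad, curl_curry_add, curl_curry_smul]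
  ring

/-- **Polarization of `φ_z`**: `φ_z(aC + bD) = a²φ_z(C) + ab[φ_z(C + D) − φ_z(C) − φ_z(D)] + b²φ_z(D)`.
[cite: Balaban1988Convergent, (3.50) p.280; Balaban1987RG1, (4.42) p.291] -/
theorem phi_lin2 (a b : ℂ) (C D : Fin d × Pt d → ℂ) (z : Pt d) :
    phi z (a • C + b • D) = a ^ 2 * phi z C
      + a * b * (phi z (C + D) - phi z C - phi z D) + b ^ 2 * phi z D := by
  simp only [phi, quad_lin2, Finset.sum_add_distrib, Finset.sum_sub_distrib, Finset.mul_sum, mul_sub]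

/-- The two-bond probe is the two-parameter family `w₀δ_{b₁} + w₁δ_{b₂}`. [cite: Balaban1988Convergent, (3.50) p.280] -/
theorem probe_eq_lin2 (b₁ b₂ : Fin d × Pt d) (w : Fin 2 → ℂ) :
    probe b₁ b₂ w = w 0 • (Pi.single b₁ (1 : ℂ) : Fin d × Pt d → ℂ) + w 1 • (Pi.single b₂ (1 : ℂ) : Fin d × Pt d → ℂ) := by
  funext p
  simp only [probe, Pi.add_apply, Pi.smul_apply, Pi.single_apply, smul_eq_mul, mul_ite, mul_one, mul_zero]

/-- `∂₀∂₁[w₀²P + w₀w₁Q + w₁²S](0) = Q`. [cite: Balaban1988Convergent, (3.50) p.280] -/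
theorem pderiv_pderiv_quad2 (P Q S : ℂ) :
    pderiv 0 (pderiv 1 (fun w : Fin 2 → ℂ => w 0 ^ 2 * P + w 0 * w 1 * Q + w 1 ^ 2 * S)) 0 = Q := by
  have e1 : pderiv 1 (fun w : Fin 2 → ℂ => w 0 ^ 2 * P + w 0 * w 1 * Q + w 1 ^ 2 * S)
      = fun w => w 0 * Q + 2 * w 1 * S := by
    funext w
    unfold pderiv
    have e : (fun t : ℂ => update w 1 t 0 ^ 2 * P + update w 1 t 0 * update w 1 t 1 * Q + update w 1 t 1 ^ 2 * S)
        = fun t => w 0 ^ 2 * P + w 0 * t * Q + t ^ 2 * S := by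
      funext t
      rw [update_of_ne (by decide : (0 : Fin 2) ≠ 1), update_self]
    rw [e]
    have h1 : HasDerivAt (fun t : ℂ => w 0 * t * Q) (w 0 * 1 * Q) (w 1) :=
      ((hasDerivAt_id' (w 1)).const_mul (w 0)).mul_const Q
    have h2 : HasDerivAt (fun t : ℂ => t ^ 2) (2 * w 1) (w 1) := by
      simpa [Pi.pow_def] using (hasDerivAt_id' (w 1)).pow 2
    have h := ((hasDerivAt_const (w 1) (w 0 ^ 2 * P)).add h1).add (h2.mul_const S)
    rw [mul_one, zero_add] at h
    exact h.deriv
  rw [e1]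
  unfold pderiv
  have e : (fun t : ℂ => update (0 : Fin 2 → ℂ) 0 t 0 * Q + 2 * update (0 : Fin 2 → ℂ) 0 t 1 * S) = fun t => t * Q := by
    funext t
    rw [update_self, update_of_ne (by decide : (1 : Fin 2) ≠ 0), Pi.zero_apply, mul_zero, zero_mul, add_zero]
  rw [e, ((hasDerivAt_id' ((0 : Fin 2 → ℂ) 0)).mul_const Q).deriv, one_mul]

/-- **THE WHOLE-LATTICE KERNEL OF THE INSTANCE IN CLOSED FORM**: `Π_{μν}(x, y, z) = Re[φ_z(δ_{(μ,x)} + δ_{(ν,y)}) −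
φ_z(δ_{(μ,x)}) − φ_z(δ_{(ν,y)})]` — the polarization of the quadratic density at the two unit bond configurations, by
`Eq358TranslInv.kernelPt_eq_re_pderiv` (all hypotheses discharged). [cite: Balaban1988Convergent, (3.50) p.280, p.281] -/
theorem kernelPt_fam_eq (μ ν : Fin d) (x y z : Pt d) :
    kernelPt 1 (fam (d := d)) μ ν x y z
      = (phi z ((Pi.single (μ, x) (1 : ℂ) : Fin d × Pt d → ℂ) + Pi.single (ν, y) (1 : ℂ))
          - phi z (Pi.single (μ, x) (1 : ℂ)) - phi z (Pi.single (ν, y) (1 : ℂ))).re := by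
  rw [kernelPt_eq_re_pderiv (U := fun _ => Set.univ) (fun X z => fam_analyticOnNhd X z) one_pos
    (fun _ => Set.subset_univ _) fam_bound_one kappa₀_le_kap μ ν x y z]
  have e : probeFn 1 fam z (μ, x) (ν, y) = fun w => w 0 ^ 2 * phi z (Pi.single (μ, x) 1)
      + w 0 * w 1 * (phi z ((Pi.single (μ, x) (1 : ℂ) : Fin d × Pt d → ℂ) + Pi.single (ν, y) 1)
          - phi z (Pi.single (μ, x) 1) - phi z (Pi.single (ν, y) 1))
      + w 1 ^ 2 * phi z (Pi.single (ν, y) 1) := by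
    funext w
    simp only [probeFn, density_fam, probe_eq_lin2, phi_lin2]
  rw [e, pderiv_pderiv_quad2]

/-- The polarized density in terms of the field strengths: `φ_z(C + D) − φ_z(C) − φ_z(D) = Σ 2(∂C)(∂D)` over the
plaquettes through `z`. [cite: Balaban1987RG1, (4.42) p.291] -/
theorem phi_polar (z : Pt d) (C D : Fin d × Pt d → ℂ) :
    phi z (C + D) - phi z C - phi z D = ∑ κ, ∑ ν,
      (2 * (curl (curry C) κ ν z * curl (curry D) κ ν z)
        + 2 * (curl (curry C) κ ν (z - unitVec κ) * curl (curry D) κ ν (z - unitVec κ))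
        + 2 * (curl (curry C) κ ν (z - unitVec ν) * curl (curry D) κ ν (z - unitVec ν))
        + 2 * (curl (curry C) κ ν (z - unitVec κ - unitVec ν) * curl (curry D) κ ν (z - unitVec κ - unitVec ν))) := by
  simp only [phi, quad, curl_curry_add, ← Finset.sum_sub_distrib]
  refine Finset.sum_congr rfl fun κ _ => Finset.sum_congr rfl fun ν _ => ?_
  ring

/-- The polarized density is additive in its first argument. [cite: Balaban1987RG1, (4.42) p.291] -/
theorem phi_polar_add_left (z : Pt d) (C₁ C₂ D : Fin d × Pt d → ℂ) :
    phi z (C₁ + C₂ + D) - phi z (C₁ + C₂) - phi z D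
      = (phi z (C₁ + D) - phi z C₁ - phi z D) + (phi z (C₂ + D) - phi z C₂ - phi z D) := by
  rw [phi_polar, phi_polar, phi_polar, ← Finset.sum_add_distrib]
  refine Finset.sum_congr rfl fun κ _ => ?_
  rw [← Finset.sum_add_distrib]
  refine Finset.sum_congr rfl fun ν _ => ?_
  simp only [curl_curry_add]
  ring

/-- The polarized density is homogeneous in its first argument. [cite: Balaban1987RG1, (4.42) p.291] -/
theorem phi_polar_smul_left (z : Pt d) (t : ℂ) (C D : Fin d × Pt d → ℂ) :
    phi z (t • C + D) - phi z (t • C) - phi z D = t * (phi z (C + D) - phi z C - phi z D) := by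
  rw [phi_polar, phi_polar, Finset.mul_sum]
  refine Finset.sum_congr rfl fun κ _ => ?_
  rw [Finset.mul_sum]
  refine Finset.sum_congr rfl fun ν _ => ?_
  simp only [curl_curry_smul]
  ring

/-- The polarized density is symmetric. [cite: Balaban1987RG1, (4.42) p.291] -/
theorem phi_polar_comm (z : Pt d) (C D : Fin d × Pt d → ℂ) :
    phi z (C + D) - phi z C - phi z D = phi z (D + C) - phi z D - phi z C := by
  rw [add_comm]
  ring

/-- The polarized density of a finite sum in the first argument. [cite: Balaban1987RG1, (4.42) p.291] -/
theorem phi_polar_sum_left {α : Type*} (z : Pt d) (s : Finset α) (f : α → Fin d × Pt d → ℂ)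
    (D : Fin d × Pt d → ℂ) :
    phi z (∑ i ∈ s, f i + D) - phi z (∑ i ∈ s, f i) - phi z D
      = ∑ i ∈ s, (phi z (f i + D) - phi z (f i) - phi z D) := by
  classical
  induction s using Finset.induction_on with
  | empty => simp [phi_zero]
  | insert a s ha ih => rw [Finset.sum_insert ha, Finset.sum_insert ha, phi_polar_add_left, ih]

/-- The polarized density of a finite sum in the second argument. [cite: Balaban1987RG1, (4.42) p.291] -/
theorem phi_polar_sum_right {α : Type*} (z : Pt d) (s : Finset α) (C : Fin d × Pt d → ℂ)
    (g : α → Fin d × Pt d → ℂ) :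
    phi z (C + ∑ i ∈ s, g i) - phi z C - phi z (∑ i ∈ s, g i)
      = ∑ i ∈ s, (phi z (C + g i) - phi z C - phi z (g i)) := by
  rw [phi_polar_comm, phi_polar_sum_left]
  exact Finset.sum_congr rfl fun i _ => phi_polar_comm z (g i) C

/-- **Locality of the kernel of the instance**: `Π_{μν}(x, y, z) = 0` unless `x ∈ □̃(z)`.
[cite: Balaban1988Convergent, (2.27)(i) p.259, (3.50) p.280] -/
theorem kernelPt_fam_eq_zero_left {μ ν : Fin d} {x y z : Pt d} (hx : x ∉ B13ScaleTransfer.block z) :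
    kernelPt 1 (fam (d := d)) μ ν x y z = 0 := by
  rw [kernelPt_fam_eq]
  have hδ : ∀ κ, ∀ s ∈ B13ScaleTransfer.block z, (Pi.single (μ, x) (1 : ℂ) : Fin d × Pt d → ℂ) (κ, s) = 0 := by
    intro κ s hs
    have hne : ((κ, s) : Fin d × Pt d) ≠ (μ, x) := fun h =>
      hx (by rw [show x = s from (congrArg Prod.snd h).symm]; exact hs)
    exact Pi.single_eq_of_ne hne _
  have h1 : phi z ((Pi.single (μ, x) (1 : ℂ) : Fin d × Pt d → ℂ) + Pi.single (ν, y) (1 : ℂ))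
      = phi z (Pi.single (ν, y) (1 : ℂ)) :=
    phi_congr fun κ s hs => by rw [Pi.add_apply, hδ κ s hs, zero_add]
  have h2 : phi z (Pi.single (μ, x) (1 : ℂ) : Fin d × Pt d → ℂ) = phi z 0 :=
    phi_congr fun κ s hs => by rw [hδ κ s hs, Pi.zero_apply]
  rw [h1, h2, phi_zero]
  simp

/-- `Π_{μν}(x, y, z) = 0` unless `y ∈ □̃(z)`. [cite: Balaban1988Convergent, (2.27)(i) p.259, (3.50) p.280] -/
theorem kernelPt_fam_eq_zero_right {μ ν : Fin d} {x y z : Pt d} (hy : y ∉ B13ScaleTransfer.block z) :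
    kernelPt 1 (fam (d := d)) μ ν x y z = 0 := by
  rw [kernelPt_fam_eq]
  have hδ : ∀ κ, ∀ s ∈ B13ScaleTransfer.block z, (Pi.single (ν, y) (1 : ℂ) : Fin d × Pt d → ℂ) (κ, s) = 0 := by
    intro κ s hs
    have hne : ((κ, s) : Fin d × Pt d) ≠ (ν, y) := fun h =>
      hy (by rw [show y = s from (congrArg Prod.snd h).symm]; exact hs)
    exact Pi.single_eq_of_ne hne _
  have h1 : phi z ((Pi.single (μ, x) (1 : ℂ) : Fin d × Pt d → ℂ) + Pi.single (ν, y) (1 : ℂ))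
      = phi z (Pi.single (μ, x) (1 : ℂ)) :=
    phi_congr fun κ s hs => by rw [Pi.add_apply, hδ κ s hs, add_zero]
  have h2 : phi z (Pi.single (ν, y) (1 : ℂ) : Fin d × Pt d → ℂ) = phi z 0 :=
    phi_congr fun κ s hs => by rw [hδ κ s hs, Pi.zero_apply]
  rw [h1, h2, phi_zero]
  simp

/-- The field strength of the linear test configuration `W_{two}(s) = s_{one}` (direction `two` only) of the
`β′` computation: `(∂W)_{κν}(w) = [ν = two](e_κ)_{one} − [κ = two](e_ν)_{one}` on EVERY plaquette.
[cite: Balaban1988Convergent, (3.61) p.282] -/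
theorem curl_linearCfg (one two κ ν : Fin d) (w : Pt d) :
    curl (curry (fun p : Fin d × Pt d => if p.1 = two then (((p.2 one : ℤ) : ℝ) : ℂ) else 0)) κ ν w
      = (if ν = two then (((unitVec κ one : ℤ) : ℝ) : ℂ) else 0)
        - (if κ = two then (((unitVec ν one : ℤ) : ℝ) : ℂ) else 0) := by
  rw [curl_curry]
  simp only [Pi.add_apply, Int.cast_add, Complex.ofReal_add]
  by_cases hκ : κ = two <;> by_cases hν : ν = two <;> simp [hκ, hν]

/-- The plane sums of the linear test configuration at `0`. [cite: Balaban1988Convergent, (3.61) p.282] -/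
theorem quad_linearCfg (one two κ ν : Fin d) :
    quad κ ν 0 (fun p : Fin d × Pt d => if p.1 = two then (((p.2 one : ℤ) : ℝ) : ℂ) else 0)
      = 4 * ((if ν = two then (((unitVec κ one : ℤ) : ℝ) : ℂ) else 0)
          - (if κ = two then (((unitVec ν one : ℤ) : ℝ) : ℂ) else 0)) ^ 2 := by
  simp only [quad, curl_linearCfg]
  ring

/-- `φ₀` of the linear test configuration is `8`: only the planes `(one, two)` and `(two, one)` contribute, `4` each
(`two ≠ one`). [cite: Balaban1988Convergent, (3.61) p.282] -/
theorem phi_linearCfg {one two : Fin d} (h12 : two ≠ one) :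
    phi 0 (fun p : Fin d × Pt d => if p.1 = two then (((p.2 one : ℤ) : ℝ) : ℂ) else 0) = 8 := by
  simp only [phi, quad_linearCfg]
  rw [Finset.sum_eq_add_of_mem one two (Finset.mem_univ _) (Finset.mem_univ _) h12.symm ?_]
  · have e1 : ∑ ν : Fin d, 4 * ((if ν = two then (((unitVec one one : ℤ) : ℝ) : ℂ) else 0)
        - (if one = two then (((unitVec ν one : ℤ) : ℝ) : ℂ) else 0)) ^ 2 = 4 := by
      rw [Finset.sum_eq_single_of_mem two (Finset.mem_univ _) (fun ν _ hν => by simp [hν, h12.symm])]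
      simp [unitVec_apply, h12.symm]
    have e2 : ∑ ν : Fin d, 4 * ((if ν = two then (((unitVec two one : ℤ) : ℝ) : ℂ) else 0)
        - (if two = two then (((unitVec ν one : ℤ) : ℝ) : ℂ) else 0)) ^ 2 = 4 := by
      rw [Finset.sum_eq_single_of_mem one (Finset.mem_univ _) (fun ν _ hν => by
        simp [unitVec_apply, Ne.symm hν, h12.symm])]
      simp [unitVec_apply, h12.symm]
    rw [e1, e2]
    norm_num
  · intro κ _ hκ
    refine Finset.sum_eq_zero fun ν _ => ?_
    simp [unitVec_apply, Ne.symm hκ.1, hκ.2]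

/-- **`β′_j = 16` FOR THE INSTANCE**: the (3.61) second moment `Σ_{x,y} Π_{22}(x, y, 0)x₁y₁` of the whole-lattice kernel of
the instance is `16` — by the closed form of the kernel, bilinearity (the double moment is the polarized density at the
linear configuration `W_{two}(s) = s_{one}·[s ∈ □̃(0)]`, i.e. `2φ₀(W)`), locality (`φ₀` reads `□̃(0)` only, where `W` is
the unrestricted linear configuration) and `(∂W)_{κν} = [κ = one][ν = two] − [κ = two][ν = one]` on every plaquette.  With
`eq364_fam`: [I]'s `β` of the instance ((1.22) second moment of the (3.63)-summed kernel) is `16` as well — (3.64) for the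
instance is an equality of two NON-ZERO numbers. [cite: Balaban1988Convergent, (3.61) p.282, (3.64) p.283] -/
theorem betaPrime_fam {one two : Fin d} (h12 : two ≠ one) : betaPrime (kernelPt 1 (fam (d := d))) one two = 16 := by
  classical
  set B : Finset (Pt d) := B13ScaleTransfer.block (0 : Pt d) with hB
  set W : Fin d × Pt d → ℂ :=
    ∑ x ∈ B, (((x one : ℤ) : ℝ) : ℂ) • (Pi.single (two, x) (1 : ℂ) : Fin d × Pt d → ℂ) with hW
  -- Step 1: the series is a finite sum over □̃(0) × □̃(0)
  unfold betaPrime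
  rw [tsum_eq_sum (s := B ×ˢ B) (fun q hq => by
    rw [Finset.mem_product, not_and_or] at hq
    rcases hq with h | h
    · rw [kernelPt_fam_eq_zero_left h, zero_mul]
    · rw [kernelPt_fam_eq_zero_right h, zero_mul])]
  rw [Finset.sum_product]
  -- Step 2: each term is the real part of the polarized density at the weighted unit configurations
  have hterm : ∀ x y : Pt d, kernelPt 1 (fam (d := d)) two two x y 0 * (((x one : ℤ) : ℝ) * ((y one : ℤ) : ℝ))
      = (phi 0 ((((x one : ℤ) : ℝ) : ℂ) • (Pi.single (two, x) (1 : ℂ) : Fin d × Pt d → ℂ)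
            + (((y one : ℤ) : ℝ) : ℂ) • (Pi.single (two, y) (1 : ℂ) : Fin d × Pt d → ℂ))
          - phi 0 ((((x one : ℤ) : ℝ) : ℂ) • (Pi.single (two, x) (1 : ℂ) : Fin d × Pt d → ℂ))
          - phi 0 ((((y one : ℤ) : ℝ) : ℂ) • (Pi.single (two, y) (1 : ℂ) : Fin d × Pt d → ℂ))).re := by
    intro x y
    rw [phi_polar_smul_left, phi_polar_comm 0 (Pi.single (two, x) (1 : ℂ)), phi_polar_smul_left,
      phi_polar_comm 0 (Pi.single (two, y) (1 : ℂ)), Complex.re_ofReal_mul, Complex.re_ofReal_mul, kernelPt_fam_eq]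
    ring
  simp only [hterm, ← Complex.re_sum]
  -- Step 3: bilinearity collapses the double sum to the polarized density at (W, W), = 2φ₀(W)
  have hcollapse : ∑ x ∈ B, ∑ y ∈ B,
      (phi 0 ((((x one : ℤ) : ℝ) : ℂ) • (Pi.single (two, x) (1 : ℂ) : Fin d × Pt d → ℂ)
            + (((y one : ℤ) : ℝ) : ℂ) • (Pi.single (two, y) (1 : ℂ) : Fin d × Pt d → ℂ))
          - phi 0 ((((x one : ℤ) : ℝ) : ℂ) • (Pi.single (two, x) (1 : ℂ) : Fin d × Pt d → ℂ))
          - phi 0 ((((y one : ℤ) : ℝ) : ℂ) • (Pi.single (two, y) (1 : ℂ) : Fin d × Pt d → ℂ)))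
      = phi 0 (W + W) - phi 0 W - phi 0 W := by
    rw [hW, phi_polar_sum_left]
    refine Finset.sum_congr rfl fun x _ => ?_
    rw [phi_polar_sum_right]
  rw [hcollapse]
  have h2W : phi 0 (W + W) = 4 * phi 0 W := by
    rw [← two_smul ℂ W, phi_smul]
    norm_num
  rw [h2W]
  -- Step 4: locality — on □̃(0) the configuration W is the unrestricted linear configuration
  have hWapply : ∀ κ, ∀ s ∈ B, W (κ, s) = (if κ = two then (((s one : ℤ) : ℝ) : ℂ) else 0) := by
    intro κ s hs
    rw [hW, Finset.sum_apply]
    simp only [Pi.smul_apply, Pi.single_apply, smul_eq_mul, mul_ite, mul_one, mul_zero, Prod.mk.injEq]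
    by_cases hκ : κ = two
    · subst hκ
      simp [Finset.sum_ite_eq, hs]
    · simp [hκ]
  rw [phi_congr (C₂ := fun p : Fin d × Pt d => if p.1 = two then (((p.2 one : ℤ) : ℝ) : ℂ) else 0)
    (fun κ s hs => hWapply κ s hs), phi_linearCfg h12]
  norm_num

/-- **[I]'s `β` OF THE INSTANCE IS `16`**: by (3.64) for the instance (`eq364_fam`) and `β′_j = 16` (`betaPrime_fam`), the
(1.22) second moment `Σ_v Π_{21}(v)v₂v₁` of the (3.63)-summed kernel of the instance equals `16` — (3.64) here is an
equality of two non-zero numbers, and the sign/index bookkeeping of `Eq364Beta.betaPrime` ((3.61)) and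
`B12Beta.secondMoment ∘ Eq363SummedKernel.sumKernel` ((3.63), [I] (1.22)) is anchored numerically.
[cite: Balaban1988Convergent, (3.64) p.283; Balaban1987RG1, (1.22) p.264] -/
theorem beta_fam {one two : Fin d} (h12 : two ≠ one) :
    B12Beta.secondMoment (sumKernel (kernelPt 1 (fam (d := d)))) two one = 16 := by
  rw [← eq364_fam h12, betaPrime_fam h12]

/-! ## §8 (v1.2). The full moment tensor `Π_{μν,κτ}` of the instance; the index restriction of (3.61) is necessary -/

/-- The field strength of the linear configuration `W^{dir,co}(s) = s_{co}` (direction `dir` only) as indicator functions: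
`(∂W)_{αβ}(w) = [α = co ∧ β = dir] − [α = dir ∧ β = co]` on every plaquette (`curl_linearCfg` with `unitVec` unfolded).
[cite: Balaban1988Convergent, (3.60)–(3.61) p.282] -/
theorem curl_linearCfg_ite (dir co α β : Fin d) (w : Pt d) :
    curl (curry (fun p : Fin d × Pt d => if p.1 = dir then (((p.2 co : ℤ) : ℝ) : ℂ) else 0)) α β w
      = (if β = dir ∧ α = co then (1 : ℂ) else 0) - (if α = dir ∧ β = co then (1 : ℂ) else 0) := by
  rw [curl_linearCfg]
  simp only [unitVec_apply]
  have e : ∀ (P : Prop) [Decidable P] (γ δ : Fin d),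
      (if P then ((((if δ = γ then (1 : ℤ) else 0) : ℤ) : ℝ) : ℂ) else 0) = if P ∧ γ = δ then (1 : ℂ) else 0 := by
    intro P _ γ δ
    by_cases hP : P
    · by_cases h : γ = δ
      · subst h
        simp [hP]
      · simp [hP, h, Ne.symm h]
    · simp [hP]
  rw [e (β = dir) α co, e (α = dir) β co]

/-- `Σ_{α,β} [α = a ∧ β = b]·[α = c ∧ β = e] = [a = c ∧ b = e]`. [cite: Balaban1988Convergent, (3.60) p.282] -/
private theorem sum_sum_ite_mul₁ (a b c e : Fin d) :
    ∑ α : Fin d, ∑ β : Fin d, ((if α = a ∧ β = b then (1 : ℂ) else 0) * (if α = c ∧ β = e then (1 : ℂ) else 0))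
      = if (a = c ∧ b = e) then (1 : ℂ) else 0 := by
  rw [Finset.sum_eq_single_of_mem a (Finset.mem_univ _) (fun α _ hα => Finset.sum_eq_zero fun β _ => by
    simp [hα])]
  rw [Finset.sum_eq_single_of_mem b (Finset.mem_univ _) (fun β _ hβ => by simp [hβ])]
  by_cases hac : a = c <;> by_cases hbe : b = e <;> simp [hac, hbe]

/-- `Σ_{α,β} [β = a ∧ α = b]·[β = c ∧ α = e] = [a = c ∧ b = e]`. [cite: Balaban1988Convergent, (3.60) p.282] -/
private theorem sum_sum_ite_mul₂ (a b c e : Fin d) :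
    ∑ α : Fin d, ∑ β : Fin d, ((if β = a ∧ α = b then (1 : ℂ) else 0) * (if β = c ∧ α = e then (1 : ℂ) else 0))
      = if (a = c ∧ b = e) then (1 : ℂ) else 0 := by
  rw [Finset.sum_eq_single_of_mem b (Finset.mem_univ _) (fun α _ hα => Finset.sum_eq_zero fun β _ => by
    simp [hα])]
  rw [Finset.sum_eq_single_of_mem a (Finset.mem_univ _) (fun β _ hβ => by simp [hβ])]
  by_cases hac : a = c <;> by_cases hbe : b = e <;> simp [hac, hbe]

/-- `Σ_{α,β} [β = a ∧ α = b]·[α = c ∧ β = e] = [a = e ∧ b = c]`. [cite: Balaban1988Convergent, (3.60) p.282] -/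
private theorem sum_sum_ite_mul₃ (a b c e : Fin d) :
    ∑ α : Fin d, ∑ β : Fin d, ((if β = a ∧ α = b then (1 : ℂ) else 0) * (if α = c ∧ β = e then (1 : ℂ) else 0))
      = if (a = e ∧ b = c) then (1 : ℂ) else 0 := by
  rw [Finset.sum_eq_single_of_mem b (Finset.mem_univ _) (fun α _ hα => Finset.sum_eq_zero fun β _ => by
    simp [hα])]
  rw [Finset.sum_eq_single_of_mem a (Finset.mem_univ _) (fun β _ hβ => by simp [hβ])]
  by_cases hae : a = e <;> by_cases hbc : b = c <;> simp [hae, hbc]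

/-- `Σ_{α,β} [α = a ∧ β = b]·[β = c ∧ α = e] = [a = e ∧ b = c]`. [cite: Balaban1988Convergent, (3.60) p.282] -/
private theorem sum_sum_ite_mul₄ (a b c e : Fin d) :
    ∑ α : Fin d, ∑ β : Fin d, ((if α = a ∧ β = b then (1 : ℂ) else 0) * (if β = c ∧ α = e then (1 : ℂ) else 0))
      = if (a = e ∧ b = c) then (1 : ℂ) else 0 := by
  rw [Finset.sum_eq_single_of_mem a (Finset.mem_univ _) (fun α _ hα => Finset.sum_eq_zero fun β _ => by
    simp [hα])]
  rw [Finset.sum_eq_single_of_mem b (Finset.mem_univ _) (fun β _ hβ => by simp [hβ])]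
  by_cases hae : a = e <;> by_cases hbc : b = c <;> simp [hae, hbc]

/-- **The polarized density of two linear configurations**: for `W₁(s) = s_κ` in direction `μ` and `W₂(s) = s_τ` in
direction `ν`, `φ₀(W₁ + W₂) − φ₀(W₁) − φ₀(W₂) = 8·Σ_{α,β}(∂W₁)_{αβ}(∂W₂)_{αβ} = 16·(δ_{μν}δ_{κτ} − δ_{μτ}δ_{κν})` (four
plaquettes per ordered plane through `0`, constant field strengths). [cite: Balaban1988Convergent, (3.60)–(3.61) p.282; Balaban1987RG1, (4.42) p.291] -/
theorem phi_polar_linearCfg (μ κ ν τ : Fin d) :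
    phi 0 ((fun p : Fin d × Pt d => if p.1 = μ then (((p.2 κ : ℤ) : ℝ) : ℂ) else 0)
            + (fun p : Fin d × Pt d => if p.1 = ν then (((p.2 τ : ℤ) : ℝ) : ℂ) else 0))
        - phi 0 (fun p : Fin d × Pt d => if p.1 = μ then (((p.2 κ : ℤ) : ℝ) : ℂ) else 0)
        - phi 0 (fun p : Fin d × Pt d => if p.1 = ν then (((p.2 τ : ℤ) : ℝ) : ℂ) else 0)
      = 16 * ((if μ = ν ∧ κ = τ then (1 : ℂ) else 0) - (if μ = τ ∧ κ = ν then (1 : ℂ) else 0)) := by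
  rw [phi_polar]
  simp only [curl_linearCfg_ite]
  have h8 : ∀ α β : Fin d,
      2 * (((if β = μ ∧ α = κ then (1 : ℂ) else 0) - (if α = μ ∧ β = κ then (1 : ℂ) else 0))
            * ((if β = ν ∧ α = τ then (1 : ℂ) else 0) - (if α = ν ∧ β = τ then (1 : ℂ) else 0)))
        + 2 * (((if β = μ ∧ α = κ then (1 : ℂ) else 0) - (if α = μ ∧ β = κ then (1 : ℂ) else 0))
            * ((if β = ν ∧ α = τ then (1 : ℂ) else 0) - (if α = ν ∧ β = τ then (1 : ℂ) else 0)))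
        + 2 * (((if β = μ ∧ α = κ then (1 : ℂ) else 0) - (if α = μ ∧ β = κ then (1 : ℂ) else 0))
            * ((if β = ν ∧ α = τ then (1 : ℂ) else 0) - (if α = ν ∧ β = τ then (1 : ℂ) else 0)))
        + 2 * (((if β = μ ∧ α = κ then (1 : ℂ) else 0) - (if α = μ ∧ β = κ then (1 : ℂ) else 0))
            * ((if β = ν ∧ α = τ then (1 : ℂ) else 0) - (if α = ν ∧ β = τ then (1 : ℂ) else 0)))
      = 8 * ((if β = μ ∧ α = κ then (1 : ℂ) else 0) * (if β = ν ∧ α = τ then (1 : ℂ) else 0))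
        - 8 * ((if β = μ ∧ α = κ then (1 : ℂ) else 0) * (if α = ν ∧ β = τ then (1 : ℂ) else 0))
        - 8 * ((if α = μ ∧ β = κ then (1 : ℂ) else 0) * (if β = ν ∧ α = τ then (1 : ℂ) else 0))
        + 8 * ((if α = μ ∧ β = κ then (1 : ℂ) else 0) * (if α = ν ∧ β = τ then (1 : ℂ) else 0)) := by
    intro α β; ring
  simp only [h8, Finset.sum_add_distrib, Finset.sum_sub_distrib, ← Finset.mul_sum, sum_sum_ite_mul₁,
    sum_sum_ite_mul₂, sum_sum_ite_mul₃, sum_sum_ite_mul₄]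
  ring

/-- **THE FULL MOMENT TENSOR OF THE INSTANCE**: for ALL indices, `Π_{μν,κτ} = Σ_{x,y} Π_{μν}(x, y, 0)x_κy_τ =
16·(δ_{μν}δ_{κτ} − δ_{μτ}δ_{κν})` — by the closed form of the kernel (`kernelPt_fam_eq`), bilinearity of the polarized
density (the double moment is the polarization at the two linear configurations `W₁ = s_κ·[s ∈ □̃(0)]` in direction `μ`,
`W₂ = s_τ·[s ∈ □̃(0)]` in direction `ν`), locality, and `phi_polar_linearCfg`.  On print's index range `κ < μ`, `τ < ν` of
the sum (3.57) this is (3.61) (`δ_{μτ}δ_{κν} = 0` there; `eq361_fam`), and `β′_j = Π_{22,11} = 16` (`betaPrime_fam`) is its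
`(2,2,1,1)` entry. [cite: Balaban1988Convergent, (3.60)–(3.61) p.282, (3.57) p.281] -/
theorem P4_fam (μ ν κ τ : Fin d) :
    P4 (kernelPt 1 (fam (d := d))) μ ν κ τ
      = 16 * ((if μ = ν ∧ κ = τ then (1 : ℝ) else 0) - (if μ = τ ∧ κ = ν then (1 : ℝ) else 0)) := by
  classical
  set B : Finset (Pt d) := B13ScaleTransfer.block (0 : Pt d) with hB
  set W₁ : Fin d × Pt d → ℂ :=
    ∑ x ∈ B, (((x κ : ℤ) : ℝ) : ℂ) • (Pi.single (μ, x) (1 : ℂ) : Fin d × Pt d → ℂ) with hW₁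
  set W₂ : Fin d × Pt d → ℂ :=
    ∑ y ∈ B, (((y τ : ℤ) : ℝ) : ℂ) • (Pi.single (ν, y) (1 : ℂ) : Fin d × Pt d → ℂ) with hW₂
  -- Step 1: the series is a finite sum over □̃(0) × □̃(0)
  unfold P4
  rw [tsum_eq_sum (s := B ×ˢ B) (fun q hq => by
    rw [Finset.mem_product, not_and_or] at hq
    rcases hq with h | h
    · rw [kernelPt_fam_eq_zero_left h, zero_mul]
    · rw [kernelPt_fam_eq_zero_right h, zero_mul])]
  rw [Finset.sum_product]
  -- Step 2: each term is the real part of the polarized density at the weighted unit configurations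
  have hterm : ∀ x y : Pt d, kernelPt 1 (fam (d := d)) μ ν x y 0 * (((x κ : ℤ) : ℝ) * ((y τ : ℤ) : ℝ))
      = (phi 0 ((((x κ : ℤ) : ℝ) : ℂ) • (Pi.single (μ, x) (1 : ℂ) : Fin d × Pt d → ℂ)
            + (((y τ : ℤ) : ℝ) : ℂ) • (Pi.single (ν, y) (1 : ℂ) : Fin d × Pt d → ℂ))
          - phi 0 ((((x κ : ℤ) : ℝ) : ℂ) • (Pi.single (μ, x) (1 : ℂ) : Fin d × Pt d → ℂ))
          - phi 0 ((((y τ : ℤ) : ℝ) : ℂ) • (Pi.single (ν, y) (1 : ℂ) : Fin d × Pt d → ℂ))).re := by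
    intro x y
    rw [phi_polar_smul_left, phi_polar_comm 0 (Pi.single (μ, x) (1 : ℂ)), phi_polar_smul_left,
      phi_polar_comm 0 (Pi.single (ν, y) (1 : ℂ)), Complex.re_ofReal_mul, Complex.re_ofReal_mul, kernelPt_fam_eq]
    ring
  simp only [hterm, ← Complex.re_sum]
  -- Step 3: bilinearity collapses the double sum to the polarized density at (W₁, W₂)
  have hcollapse : ∑ x ∈ B, ∑ y ∈ B,
      (phi 0 ((((x κ : ℤ) : ℝ) : ℂ) • (Pi.single (μ, x) (1 : ℂ) : Fin d × Pt d → ℂ)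
            + (((y τ : ℤ) : ℝ) : ℂ) • (Pi.single (ν, y) (1 : ℂ) : Fin d × Pt d → ℂ))
          - phi 0 ((((x κ : ℤ) : ℝ) : ℂ) • (Pi.single (μ, x) (1 : ℂ) : Fin d × Pt d → ℂ))
          - phi 0 ((((y τ : ℤ) : ℝ) : ℂ) • (Pi.single (ν, y) (1 : ℂ) : Fin d × Pt d → ℂ)))
      = phi 0 (W₁ + W₂) - phi 0 W₁ - phi 0 W₂ := by
    rw [hW₁, hW₂, phi_polar_sum_left]
    refine Finset.sum_congr rfl fun x _ => ?_
    rw [phi_polar_sum_right]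
  rw [hcollapse]
  -- Step 4: locality — on □̃(0) the configurations W₁, W₂ are the unrestricted linear configurations
  have hW₁apply : ∀ α, ∀ s ∈ B, W₁ (α, s) = (if α = μ then (((s κ : ℤ) : ℝ) : ℂ) else 0) := by
    intro α s hs
    rw [hW₁, Finset.sum_apply]
    simp only [Pi.smul_apply, Pi.single_apply, smul_eq_mul, mul_ite, mul_one, mul_zero, Prod.mk.injEq]
    by_cases hα : α = μ
    · subst hα
      simp [Finset.sum_ite_eq, hs]
    · simp [hα]
  have hW₂apply : ∀ α, ∀ s ∈ B, W₂ (α, s) = (if α = ν then (((s τ : ℤ) : ℝ) : ℂ) else 0) := by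
    intro α s hs
    rw [hW₂, Finset.sum_apply]
    simp only [Pi.smul_apply, Pi.single_apply, smul_eq_mul, mul_ite, mul_one, mul_zero, Prod.mk.injEq]
    by_cases hα : α = ν
    · subst hα
      simp [Finset.sum_ite_eq, hs]
    · simp [hα]
  have hW₁₂apply : ∀ α, ∀ s ∈ B, (W₁ + W₂) (α, s)
      = ((fun p : Fin d × Pt d => if p.1 = μ then (((p.2 κ : ℤ) : ℝ) : ℂ) else 0)
          + (fun p : Fin d × Pt d => if p.1 = ν then (((p.2 τ : ℤ) : ℝ) : ℂ) else 0)) (α, s) := by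
    intro α s hs
    simp only [Pi.add_apply, hW₁apply α s hs, hW₂apply α s hs]
  rw [phi_congr hW₁₂apply,
    phi_congr (C₁ := W₁) (C₂ := fun p : Fin d × Pt d => if p.1 = μ then (((p.2 κ : ℤ) : ℝ) : ℂ) else 0)
      (fun α s hs => hW₁apply α s hs),
    phi_congr (C₁ := W₂) (C₂ := fun p : Fin d × Pt d => if p.1 = ν then (((p.2 τ : ℤ) : ℝ) : ℂ) else 0)
      (fun α s hs => hW₂apply α s hs),
    phi_polar_linearCfg]
  split_ifs <;> norm_num

/-- **`Π_{12,21} = −16` for the instance** (`two ≠ one`): an entry OUTSIDE print's index range `κ < μ`, `τ < ν` of (3.57)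
that is non-zero although `(μ, ν) = (1, 2)` is off-diagonal. [cite: Balaban1988Convergent, (3.61) p.282, (3.57) p.281] -/
theorem P4_fam_cross {one two : Fin d} (h12 : two ≠ one) :
    P4 (kernelPt 1 (fam (d := d))) one two two one = -16 := by
  rw [P4_fam]
  simp [h12, Ne.symm h12]

/-- **THE INDEX RESTRICTION OF (3.61) IS NECESSARY**: without print's restriction `κ < μ`, `λ < ν` (the summation range of
(3.57), p. 281: *"Σ_{κ<μ, λ<ν}"*), the identity *"Π_{μν,κλ} = δ_{μν}δ_{κλ}Π_{μ₀μ₀,κ₀κ₀}"* FAILS for the instance as soon as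
`d ≥ 2` (at `(μ, ν, κ, λ) = (1, 2, 2, 1)`: `−16 ≠ 0`), while WITH the restriction it holds (`eq361_fam`) — the typed
restriction in `Eq358TranslInv.eq361_kernelPt` / `Eq360TensorInvariance.eq361_of_covariance` is not an artefact of the
typing. [cite: Balaban1988Convergent, (3.61) p.282, (3.57) p.281] -/
theorem eq361_restriction_necessary {one two : Fin d} (h12 : two ≠ one) (μ₀ κ₀ : Fin d) :
    ¬ ∀ μ ν κ' τ : Fin d, P4 (kernelPt 1 (fam (d := d))) μ ν κ' τ
        = if (μ = ν ∧ κ' = τ) then P4 (kernelPt 1 (fam (d := d))) μ₀ μ₀ κ₀ κ₀ else 0 := by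
  intro h
  have h' := h one two two one
  rw [P4_fam_cross h12, if_neg (fun hc => h12 hc.1.symm)] at h'
  norm_num at h'

end

end Literature.MathematicalPhysics.QuantumFieldTheory.Balaban1983to89.B14.Eq358ModelInstance
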